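import Summits.AtomisticToContinuum.HydrodynamicLimit.Theses.ImplosionDichotomy
import Summits.AtomisticToContinuum.HydrodynamicLimit.Theses.LaxScheme
import Summits.AtomisticToContinuum.HydrodynamicLimit.Theses.OneFlightGossipEngine
import Literature.MathematicalPhysics.KineticTheory.HardSphereEulerLLN
import Literature.Analysis.FluidPDE.CollisionalTransfer
import Literature.Analysis.FluidPDE.CompressibleEulerPrimitiveForm
import Literature.MathematicalPhysics.KineticTheory.HardSphereEulerProofs
import Summits.AtomisticToContinuum.HydrodynamicLimit.Theorems.ImplosionDichotomyHydroLimitInBandEntropyDock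
import Summits.AtomisticToContinuum.HydrodynamicLimit.Theorems.ImplosionDichotomyHydroLimitInBandCoreReduction
import Summits.AtomisticToContinuum.HydrodynamicLimit.Theorems.ImplosionDichotomyHydroLimitInBandWindowBalance
import Summits.AtomisticToContinuum.HydrodynamicLimit.Theorems.ImplosionDichotomyHydroLimitInBandEulerPrimitive
import Summits.AtomisticToContinuum.HydrodynamicLimit.Theorems.TwoClocksClampedEntropyClockDiscreteEntropyGronwall
import Summits.AtomisticToContinuum.HydrodynamicLimit.Theorems.TwoClocksClampedEntropyClockTimeZeroReference
import Summits.AtomisticToContinuum.HydrodynamicLimit.Theorems.OneFlightGossipEngineUniformLocalGibbsConcentration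
import Summits.AtomisticToContinuum.HydrodynamicLimit.Theorems.OneFlightGossipEngineClampedCurrentsDockMessenger
import Summits.AtomisticToContinuum.HydrodynamicLimit.Theorems.OneFlightGossipEngineClampedCurrentsDockGronwall
import Summits.AtomisticToContinuum.HydrodynamicLimit.Theorems.ImplosionDichotomyHydroLimitInBandWindowContinuity
import Summits.AtomisticToContinuum.HydrodynamicLimit.Theorems.ImplosionDichotomyHydroLimitInBandStaticClause
import Summits.AtomisticToContinuum.HydrodynamicLimit.Theorems.ImplosionDichotomyHydroLimitInBandReferenceIdentification
import Summits.AtomisticToContinuum.HydrodynamicLimit.Theorems.ImplosionDichotomyHydroLimitInBandLedgerApriori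
import Summits.AtomisticToContinuum.HydrodynamicLimit.Theorems.OneFlightGossipEngineClampedCurrentsDockLedgerGlue
import Summits.AtomisticToContinuum.HydrodynamicLimit.Theorems.OneFlightGossipEngineClampedCurrentsDockPathwise
import Summits.AtomisticToContinuum.HydrodynamicLimit.Theorems.OneFlightGossipEngineClampedCurrentsDockCancellation
import Summits.AtomisticToContinuum.HydrodynamicLimit.Theorems.OneFlightGossipEngineClampedCurrentsDockEos
import Summits.AtomisticToContinuum.HydrodynamicLimit.Theorems.OneFlightGossipEngineClampedCurrentsDockClampRemainder
import Summits.AtomisticToContinuum.HydrodynamicLimit.Theorems.OneFlightGossipEngineClampedCurrentsDockFromWindows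
import Summits.AtomisticToContinuum.HydrodynamicLimit.Theorems.ImplosionDichotomyHydroLimitInBandWindowClause
import Summits.AtomisticToContinuum.HydrodynamicLimit.Theorems.ImplosionDichotomyHydroLimitInBandSplit
import Summits.AtomisticToContinuum.HydrodynamicLimit.Theorems.OneFlightGossipEngineClampedTransferDockOfInputs
import Summits.AtomisticToContinuum.HydrodynamicLimit.Theorems.OneFlightGossipEngineClampedTransferDockSeet
import Summits.AtomisticToContinuum.HydrodynamicLimit.Theorems.ImplosionDichotomyHydroLimitInBandSignedBandDefs
import Summits.AtomisticToContinuum.HydrodynamicLimit.Theorems.ImplosionDichotomyHydroLimitInBandCubicChannelS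
import Summits.AtomisticToContinuum.HydrodynamicLimit.Theorems.ImplosionDichotomyHydroLimitInBandKineticInstanceOrth
import Summits.AtomisticToContinuum.HydrodynamicLimit.Theorems.ImplosionDichotomyHydroLimitInBandWindowClauseS
import Summits.AtomisticToContinuum.HydrodynamicLimit.Theorems.ImplosionDichotomyHydroLimitInBandBandShiftStatics

/-!
# Line `IdeatorOneSketch` (card `in-band-entropy-clock`) — checked skeleton for the crux `HydroLimitInBand`
(stmt-AtomisticToContinuum-9133; route ImplosionDichotomy, decl
`Summit.AtomisticToContinuum.HydrodynamicLimit.Theses.ImplosionDichotomy.HydroLimitInBand`; the item is shared; the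
byte-identical LaxScheme copy of the decl was dropped by route LaxScheme at rev 5, so since v12 the composition is typed once)

v16 (lead `…-9133-c17-0`, line cycle 18): RESHAPE — v15's one stub `stub_itemizedInputs` is STUB-FALSE (its conjunct
BandCoherenceLDAlongFamilies, stmt-17700, is refuted by the Galilean-boost witness: refuter rattack-17700-0, crux-ideate 17700 k1/k2, ¬BCL
being landed by the 17700 lead). The composition is re-threaded around BCL by the repair R1 (signed band remainder, Nachtergaele–Yau
truncation re-orthogonalised to the collision invariants, paid by the two-sided entropy inequality at the K₁-scaled tilt), which needs the
kinetic window LD with a CLASS-UNIFORM tilt threshold, `KineticCurrentsLDAlongFamiliesQ` (KCWF-Q ⟹ KCWF = 16659). See §5 (v16). Registered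
stubs: `stub_kcwfQ` (conjecture-grade input, to be promoted to an item), `stub_items4` = SEET (17701) ∧ LCT (17691) ∧ EAT (17703) ∧ CAT
(13734) (items, delegated), `stub_bandShiftStatics` (CLOSED p147261) / `stub_kineticInstanceOrth` (CLOSED p146924) / `stub_windowClauseRateS` (CLOSED p146888),
`stub_cubicChannelRateS` (provable; lead — CLOSED p146424 this cycle). `HydroLimitInBand_of` concludes the crux BY NAME from them over landed theorems only.

v15 (lead `…-9133-c14-0`, line cycle 15, end): v14 with the provable binder 17733 DISCHARGED IN PLACE — `HydroLimitInBand_of` is now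
the landed `ClampedTransferDockSketch.clampedTransferDock_of_inputs` (p140743) with ECT supplied by the landed
`ClampedTransferDockSeet.seet_imp_energyCurrentTails` (p141132), applied to the ONE registered stub `stub_itemizedInputs` = the bundle
of the SIX conjecture-grade item decls SEET (17701) ∧ BandCoherenceLDAlongFamilies (17700) ∧ LocalClampedTransferLDAlongFamilies (17691)
∧ EnergyActivityTails (17703) ∧ KineticCurrentsLDAlongFamilies (16659) ∧ CollisionActivityTails (13734); this kernel-certifies, from
9133's side, that the binder 17733 is exactly the landed composition (the Theorems copies of SEET / BandCoherenceLD and the route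
items agree definitionally).

v14 (lead `…-9133-c14-0`, line cycle 15, after wave 1): ALL INPUTS ARE ITEMS — ONE registered stub `stub_itemizedInputs`, the
bundle (NOT a worker target) of SEVEN item decls of route OneFlightGossipEngine, verbatim by name: the binder
`ClampedTransferDockOfInputs` (stmt-17733, PROVABLE NOW = the landed `ClampedTransferDockSketch.clampedTransferDock_of_inputs`
p140743 ∘ `SEET → ECT`, being landed by the 17615 lead) and its six conjecture-grade antecedents SEET (stmt-17701),
BandCoherenceLDAlongFamilies (stmt-17700), LocalClampedTransferLDAlongFamilies (stmt-17691 = this line's LCTF, Iff.rfl),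
EnergyActivityTails (stmt-17703 = CEAT), KineticCurrentsLDAlongFamilies (stmt-16659 = KCWF), CollisionActivityTails (stmt-13734 = CAT)
— the four inputs promoted by the sibling dock's lead were FILED by the OneFlightGossipEngine planner at 2026-08-17T04:29Z, during
this cycle's wave. PATH A (registered composition `HydroLimitInBand_of`): the same one-window entropy ledger in band with the cubic
channel re-threaded AT A RATE (sibling line `Sketch` of crux 17615: band `(K⋆,K₁]` paid by `BandCoherenceLD…` under the REFERENCE law,
top `> K₁` by SEET), which removes this line's un-itemed true-law coherence input CSCV-W; wave 1 of this cycle showed CSCV-W is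
question-begging in the same way as `BoundedOddWindowLLN` (CSCV-W ⇐ BoundedOddWindowLLN ∧ ECT by the landed p140531) and that
LCTF ⇒ C′ (stmt-16623) along constant families (worker lemma, landed separately). PATH B (v1–v13's composition through
`LineInputs` = LCTF ∧ CEAT ∧ CSCV-W ∧ KCWF ∧ CAT ∧ ECT) is kept sorry-free with its inputs as hypotheses:
`hydrodynamicLimit_of_coherencePath` (= the landed `HydroLimitInBandSplit.hydroLimitInBand_of_lineInputs`, typed at the Statement).

v13 (lead `…-9133-c14-0`, line cycle 15): v12 + `import …Theorems.ImplosionDichotomyHydroLimitInBandSplit` and §5 UNBUNDLED BY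
OWNERSHIP — the former single stub `stub_inputs : LineInputs` is now DERIVED (sorry-free) from three registered stubs typed BY NAME
as tree declarations: `stub_lctf : HydroLimitInBandOfHeart.LocalClampedTransferWindowLDFamily` and
`stub_cscvW : HydroLimitInBandOfHeart.CoherentSuprathermalContentVanishesW` (the two inputs that are items NOWHERE — SPLIT-REQUEST
children 2–3, un-owned since 2026-08-17T00:46Z: first-class stubs of this crux from now on, so stub seats / the disprover can address
them) and the DELEGATED bundle `stub_itemizedChildren : KCWF ∧ TAT ∧ ECT` (verbatim the decls of the open items stmt-16659 /
stmt-16624 / stmt-9235, each driven by its own line lead — NOT a worker target; discharged conjunct-wise by those items' closing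
theorems). The derivation of `stub_inputs` doubles as a kernel check that this file's §2 copies of the six inputs are
definitionally the tree's (`HydroLimitInBandOfHeart` §2, `OneFlightGossipEngine`, `TwoClocks` via
`HydroLimitInBandHeart.activityTails_of_transferActivityTails`). Composition unchanged (`HydroLimitInBand_of`); equivalently
`HydroLimitInBandSplit.HydroLimitInBand_of_subs stub_itemizedChildren.1 stub_lctf stub_cscvW stub_itemizedChildren.2.1
stub_itemizedChildren.2.2` (p136061) — recorded as `hydroLimitInBand_of_subs_check`.

v12 (lead `…-9133-c7-0`, line cycle 8; prepared by leads c4–c6, cycles 5–7): v11 + `import …Theorems.ImplosionDichotomyHydroLimitInBandWindowClause`,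
`stub_windowClause := Theorems.HydroLimitInBandHeart.stub_windowClause` (LANDED p127017) — ONE `sorry` left: `stub_inputs : LineInputs`
— and the LaxScheme-typed twin `HydroLimitInBand_proof` removed (route LaxScheme dropped its copy of the
shared crux at rev 5, 2026-08-16T23:34Z; OfHeart repaired by p135796) (five conjecture-grade inputs: KCWF = stmt-16659, TAT = stmt-16624 ⇒ CAT ∧ CEAT (p126055), ECT = stmt-9235, LCTF and CSCV-W typed in
`…HydroLimitInBandOfHeart` §2 and requested as items in `Cruxes/HydroLimitInBand/SPLIT-REQUEST.md`).

Leads: `prover-line-stmt-AtomisticToContinuum-9133-0` (cycle 1, skeletons v1–v5), `…-9133-c1-0` (cycle 2, v6–v7),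
`…-9133-c2-0` (cycle 3, v8–v9), `…-9133-c3-0` (cycle 4, v10–v11: the landed window continuity p118327 is imported and
`stub_windowContinuityInBand` is a one-liner; v11 cuts the shared heart at its two CLAUSES with the centring function made
explicit — `stub_staticClause : StaticClauseInBand` (L, provable now from the sibling's landed SC-a/SC-b) and
`stub_windowClause : WindowClause` (XL, the heart proper) — joined by the sorry-free glue `oneWindowLedgerStatic_of_clauses`, so
`stub_oneWindowLedgerInBand : OneWindowLedger` is a one-liner; `sorry` remain in `stub_inputs` (the six open inputs, by design)
and the two clause stubs).

## The line in one sentence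

THE GUARD COMMUTES WITH THE ENTROPY CLOCK. `HydroLimitInBand` (the packing-guarded conjunct, `∃ η₀` outermost)
follows from the GUARDED Yau target `RelEntropyVanishingInBand` by the landed entropy inequality — `stub_dock`; the
guarded Yau target follows from the GUARDED GRONWALL CORE `GronwallCoreInBand` (Yau's relative-entropy estimate along a
handed-over dilute reference, asked only for classical solutions whose packing stays `< η_c` on `[0,T)`) by the landed
statics — `stub_reduction`; and the guarded core is what the ONE-WINDOW ENTROPY LEDGER delivers when its inputs hold —
with the single structural difference from the sibling clocks (`TwoClocks.ClampedWindowDock` 13735,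
`OneFlightGossipEngine.ClampedCurrentsDock` 14680, `TwoClocks.ClampedEntropyClock` 15145) that `DiluteSelfConsistency`
(stmt-3091, suspect as typed) is NOT a hypothesis: inside the band the guard supplies, at every `s ≤ t`, exactly the
packing bound those clocks draw from 3091, so every static input is a theorem and the reference activity
`a_s = ρ_s · Rf(σ³ρ_s)` stays in the cluster radius.

## Skeleton v7 (cycle 2): the ledger is the SIBLING'S ledger, in band

v6 cut the Grönwall core along Yau's telescoping with an `(A, ε)`-per-accuracy discrete Grönwall (G1′, LANDED p107365),
the reference identification (G3, LANDED p107756) and a one-window heart fed by re-typed inputs S4′/T′/Gaussian tails.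
Wave 1 of cycle 2 returned `stub-misstated` on R3 (localisation of C′): the local clamped collisional LD needs a packing
guard, and its nearest existing statement is the sibling crux ClampedCurrentsDock's `ClampedTransferLocalisation`
(`MessengerSparsity → C′ → LocalClampedTransferWindowLD`, MessengerSparsity LANDED p103490). v7 therefore DOCKS THE WHOLE
LEDGER TO THE SIBLING LINE `ClampedCurrentsDock/Lines/IdeatorTwoSketch.lean` (eleven landed pieces: pathwise production,
Euler streaming identity, EOS consistency, pointwise Euler cancellation, transfer-clamp remainder, heat-flux cut-off and
split, monotone Grönwall, messenger sparsity, time zero, ledger Grönwall end): the inputs are ITS inputs verbatim (board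
items `KineticCurrentsWindowLDUniform` 14662, `CollisionActivityTails` 13734, `EnergyCurrentTails` 9235 by name; C′, the
energy-activity tails and the coherent-suprathermal bet copied byte-identically), R3 is ITS localisation stub verbatim, the
a-priori bound is ITS S7a verbatim, and THE HEART is ITS integrated ledger S7b with `HsEosLowDensity → DiluteSelfConsistency`
REPLACED BY THE GUARD (`LedgerIntegratedCoreInBand`): whoever proves the sibling's S7b with the packing of `ρ_s` read from a
hypothesis instead of 3091 proves this heart, and conversely. The v6 `(A, ε)` pieces stay in the file as a documented,
sorry-free alternative end (`gronwallCoreInBand_of_pieces`, removed in v8) for a clock that removes a velocity cut-off.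

## Skeleton v8 (cycle 3): FAMILY-UNIFORM reference-law inputs; the heart cut at the window joints

CONSUMER-SIDE FINDING (lead c2, `UNIFORMITY-9133-c2.md` on the item). The two REFERENCE-LAW LD inputs the v7 heart
consumed — the board's `OneFlightGossipEngine.KineticCurrentsWindowLDUniform` (14662) and the sibling's
`LocalClampedTransferWindowLD` — quantify their thresholds `V₀, β₀, τ₀, N₀` POINTWISE in the reference profiles and the test
data, whereas an entropy clock along the time-dependent reference `ψ_s = (ρ_s Rf(σ³ρ_s), u_s, θ_s)`, `s ∈ [0,t]`, applies them
at an `N`-dependent, asymptotically dense set of window starts. A FIXED finite net `{s_j}` in `s` leaves, in every window, an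
extensive change-of-reference cost at a FIXED rate (Rényi/Hölder comparison of `ψ_s` with `ψ_{s_j}`: `(N+1)·c·|s − s_j|²`,
i.e. `t·c·δ₀²/β` per unit entropy), so the net must refine with the target `ε`; but then the pointwise thresholds degrade
without bound — the Skolem function `β₀(ψ_s) := min(1, |s − t/2|)` (`β₀(ψ_{t/2}) := 1`) is consistent with the inputs and
forces, for every net of fineness `δ`, a tilt `≲ δ`, hence a Grönwall rate `K(ε) ≳ 1/ε` and `ε·e^{K(ε)t} → ∞`: neither the
fixed-`K` integrated ledger (v7 heart, and the sibling 14680's S7b) nor the `(A, ε)`-per-accuracy clock (v6) is derivable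
from pointwise inputs. The true-law inputs CAT / CEAT / ECT / CSCV are already typed `∀ s ∈ [0,t]` innermost and are fine.
v8 therefore RETYPES the two reference-law inputs FAMILY-UNIFORMLY — `KineticCurrentsWindowLDFamily`,
`LocalClampedTransferWindowLDFamily`: thresholds uniform along jointly continuous one-parameter families of profiles and
test data on `[0,t₁]`, `∀ s ∈ [0,t₁]` innermost, window quantifier `∃ τ₀ ∀ τ ≥ τ₀` (a COMMON window for all channels; no
multi-window ledger) — and cuts the XL heart at its two honest joints: `stub_windowContinuityInBand` (crude short-time
continuity of `H_N`, from CAT + CEAT + ECT: provable now, L), `stub_oneWindowLedgerInBand` (THE HEART PROPER: one common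
window, END-supremum form) and `stub_ledgerFromWindows` (the multi-window summation: left Riemann sums of the running
supremum + continuity + S7a + time zero ⇒ `LedgerIntegratedCoreInBand`; M, lead, closing this cycle). R3 (localisation,
= the sibling's S5b, recommended for promotion to ONE shared item by that lead) leaves the skeleton: the line's collisional
input is the LOCAL family-uniform LD itself. Wave 1 of cycle 3 LANDED `stub_windowContinuityInBand` (p118327; periphery
`…WindowContinuityFields/Transfer/Streaming/Kinematics/Estimate.lean` p113113 p113114 p113521 p115206 p116090).

## Skeleton v9 (cycle 3, second half): ONE heart layer for both cruxes

Between 16:18Z and 18:07Z the sibling lead (14680-c1/c2) ENDORSED the uniformity finding, adopted this file's v8 heart layer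
byte-identically (`LedgerIntegratedCoreInBand`, `WindowContinuityInBand`, the two family typings), and added two further input
findings of its own: CUTOFF-MATCHING (the sharp coherence input forces a discontinuous thermal cut-off into the kinetic class ⇒
radially weighted coherence input `CoherentSuprathermalContentVanishesW`) and STATIC-TELESCOPING (the per-window static residual
`Δ log Z_pos + w(N+1)Cst(s)` is not provably `o(w(N+1))` with the statics at hand, but telescoped it is `o(N+1)` ⇒ the heart
proper carries the static term explicitly: `OneWindowLedgerStatic`; summation `LedgerFromWindowsS`, LANDED by that lead, p117552).
v9 adopts all three VERBATIM, so that the two skeletons now share ONE heart: `stub_oneWindowLedgerInBand : OneWindowLedger` here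
IS the sibling's registered `stub_oneWindowLedger : OneWindowLedger` (same body; the four leading hypotheses are the sibling's
LANDED S2 / S8 / S4 / S10, discharged in `core_of_stubs` by name) — ONE landed proof closes both; the sibling lead drives its
interior (registered channel lemmas KC1, CC1, CC3, static telescoping/limit, cubic channel, flow-shift/freeze, clamped
measurability — eleven helper files landed 18:00–19:15Z). Local copies of G3 / S7a / the running-supremum Grönwall are
replaced by imports (farm built). The v8 static-free joint `OneWindowLedgerInBand`/`stub_ledgerFromWindows` is retired from the
composition (its summation `HydroLimitInBandLedger.stub_ledgerFromWindows` LANDED as a support, p122442 — reusable real-analysis core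
`ledger_sum_of_windows`).

## Stubs (registered; `sorry` only inside them) — hardest: `stub_oneWindowLedgerInBand`

* CLOSED: `stub_dock` (p97115), `stub_reduction` (p97252), `stub_windowEntropyBalance` (R1, p102880),
  `stub_eulerPrimitiveInBand` (R4, p103739), `stub_discreteEntropyGronwallVar` (G1′, p107365),
  `stub_referenceIdentificationInBand` (G3, p107756), `stub_ledgerAprioriBound` (S7a, p109679),
  `stub_windowContinuityInBand` (p118327; imported since v10), `stub_ledgerFromWindowsS`
  (sibling, p117552); helper `toReal_klDiv_window_sub_le` (p106991).
* OPEN (v16): `stub_kcwfQ`, `stub_items4`, `stub_bandShiftStatics`, `stub_kineticInstanceOrth`, `stub_cubicChannelRateS`,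
  `stub_windowClauseRateS` (§5 v16). RETIRED (v15, stub-false): `stub_itemizedInputs` — 17701 SEET ∧ 17700 BandCoherenceLD ∧ 17691 LCTF ∧ 17703 CEAT ∧ 16659 KCWF ∧ 13734 CAT,
  all conjecture-grade items of route OneFlightGossipEngine with their own seats (v14's 7th conjunct, the binder 17733, is discharged
  in place by p140743 + p141132) (v13's `stub_lctf` / `stub_cscvW` /
  `stub_itemizedChildren` are retired: LCTF is item 17691, CSCV-W is replaced by the itemized pair SEET + BandCoherenceLD).
* `stub_staticClause : StaticClauseInBand` (v11; L, provable now) and `stub_windowClause : WindowClause` (v11; XL, THE HEART PROPER)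
  — the two clauses of the shared heart `stub_oneWindowLedgerInBand : OneWindowLedger` (one-liner over them since v11; equally
  closed by the sibling's `stub_oneWindowLedger` when that lands first).

`HydroLimitInBand_of` / `HydroLimitInBand_proof` compose them and conclude the crux BY NAME.
-/

noncomputable section

open MeasureTheory Filter Set Topology InformationTheory
open scoped ENNReal

namespace Summit.AtomisticToContinuum.HydrodynamicLimit.Cruxes.HydroLimitInBand.IdeatorOneSketch

open Literature.MathematicalPhysics.KineticTheory Literature.Analysis.FluidPDE Literature.Analysis.FunctionSpaces
open Summit.AtomisticToContinuum.HydrodynamicLimit.Theses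
open Summit.AtomisticToContinuum.HydrodynamicLimit.Theorems (stub_eosRatioAnalytic uniformLocalGibbsConcentration_proof)
open Summit.AtomisticToContinuum.HydrodynamicLimit.Theorems.PolynomialCompressionStatics (integral_rhoLim_eq_one)
open Summit.AtomisticToContinuum.HydrodynamicLimit.Theorems.ClampedCurrentsDockGronwall (stub_monotoneGronwall)
open Summit.AtomisticToContinuum.HydrodynamicLimit.Theorems.ClampedCurrentsDockPathwise (PathwiseEntropyProduction)
open Summit.AtomisticToContinuum.HydrodynamicLimit.Theorems.ClampedCurrentsDockCancellation (EulerCancellation)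
open Summit.AtomisticToContinuum.HydrodynamicLimit.Theorems.ClampedCurrentsDockEos (EosConsistency)
open Summit.AtomisticToContinuum.HydrodynamicLimit.Theorems.ClampedCurrentsDockClampRemainder (TransferClampRemainder)

/-! ## §1 The two intermediate statements of the line (unchanged since v1) -/

/-- **The GUARDED Yau target** (C⁺ of the line): the shared typed target `TwoClocks.RelEntropyVanishing` (stmt-0766) with
the packing guard of the crux inserted after the Euler solution — `∃ η₀ > 0` OUTERMOST. -/
def RelEntropyVanishingInBand : Prop :=
  ∃ η₀ : ℝ, 0 < η₀ ∧ ∀ (a₀ θ₀ : T3 → ℝ) (u₀ : T3 → V3), Continuous a₀ → Continuous θ₀ → Continuous u₀ →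
    (∀ x, 0 < a₀ x) → (∀ x, 0 < θ₀ x) → ∃ σ₀ : ℝ, 0 < σ₀ ∧ ∀ σ : ℝ, 0 < σ → σ < σ₀ →
    ∀ (T : ℝ) (ρ θ : ℝ → T3 → ℝ) (u : ℝ → T3 → V3), IsHardSphereEulerSolution σ T ρ u θ →
    (∀ t ∈ Set.Ico 0 T, ∀ x, ρ t x * σ ^ 3 < η₀) →
    ∀ Φ : (N : ℕ) → HardSphereFlow (Torus.geometry (Fin 3)) (hsDiameter σ N) (N + 1),
    (∀ N, IsProbabilityMeasure (localGibbsLaw σ a₀ u₀ θ₀ N (Φ N))) ∧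
    (TendstoHydroFieldsAt (fun N => localGibbsLaw σ a₀ u₀ θ₀ N (Φ N)) Φ ρ u θ 0 →
      ∀ t ∈ Set.Ico 0 T, ∃ a : T3 → ℝ,
      (∀ N, IsProbabilityMeasure (localGibbsLaw σ a (u t) (θ t) N (Φ N))) ∧
      (∀ χ : T3 → ℝ, Continuous χ → ∀ δ : ℝ, 0 < δ → ∃ C : ℝ, 0 < C ∧ ∀ N : ℕ,
        localGibbsLaw σ a (u t) (θ t) N (Φ N)
            {z | δ < |empiricalDensityField z χ - ∫ x, χ x * ρ t x|} ≤
          ENNReal.ofReal (C * Real.exp (-(C⁻¹ * (N + 1)))) ∧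
        localGibbsLaw σ a (u t) (θ t) N (Φ N)
            {z | δ < ‖empiricalMomentumField z χ - ∫ x, (χ x * ρ t x) • u t x‖} ≤
          ENNReal.ofReal (C * Real.exp (-(C⁻¹ * (N + 1)))) ∧
        localGibbsLaw σ a (u t) (θ t) N (Φ N)
            {z | δ < |empiricalEnergyField z χ -
              ∫ x, χ x * totalEnergyDensity (ρ t x) (u t x) (θ t x)|} ≤
          ENNReal.ofReal (C * Real.exp (-(C⁻¹ * (N + 1))))) ∧
      Tendsto (fun N : ℕ => klDiv ((Φ N).lawAt (localGibbsLaw σ a₀ u₀ θ₀ N (Φ N)) t)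
        (localGibbsLaw σ a (u t) (θ t) N (Φ N)) / ((N : ℝ≥0∞) + 1)) atTop (𝓝 0))

/-- **The GUARDED GRONWALL CORE** (Yau's relative-entropy estimate along a handed-over reference, in band): verbatim the
hypothesis `gronwall` of the landed `EntropyClockDock.clampedWindowDock_of_gronwall` (13735) with `DiluteSelfConsistency`
replaced by the guard `ρ_t(x)σ³ < η_c` on `[0,T) × 𝕋³`. -/
def GronwallCoreInBand : Prop :=
  ∃ ηc : ℝ, 0 < ηc ∧ ∀ (a₀ θ₀ : T3 → ℝ) (u₀ : T3 → V3), Continuous a₀ → Continuous θ₀ → Continuous u₀ →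
    (∀ x, 0 < a₀ x) → (∀ x, 0 < θ₀ x) → ∃ σ₀ : ℝ, 0 < σ₀ ∧ ∀ σ : ℝ, 0 < σ → σ < σ₀ →
    ∀ (T : ℝ) (ρ θ : ℝ → T3 → ℝ) (u : ℝ → T3 → V3), IsHardSphereEulerSolution σ T ρ u θ →
    (∀ t ∈ Set.Ico 0 T, ∀ x, ρ t x * σ ^ 3 < ηc) →
    ∀ Φ : (N : ℕ) → HardSphereFlow (Torus.geometry (Fin 3)) (hsDiameter σ N) (N + 1),
    TendstoHydroFieldsAt (fun N => localGibbsLaw σ a₀ u₀ θ₀ N (Φ N)) Φ ρ u θ 0 →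
    ∀ t ∈ Set.Ioo 0 T, ∀ (a : T3 → ℝ) (hac : Continuous a) (hap : ∀ x, 0 < a x),
      (∀ x, ρ t x ≤ a x ∧ a x ≤ 2 * ρ t x) → SmallDensity (profileOf a hac hap) σ →
      rhoLim (profileOf a hac hap) σ = ρ t →
      Tendsto (fun N : ℕ => klDiv ((Φ N).lawAt (localGibbsLaw σ a₀ u₀ θ₀ N (Φ N)) t)
        (localGibbsLaw σ a (u t) (θ t) N (Φ N)) / ((N : ℝ≥0∞) + 1)) atTop (𝓝 0)

/-- **The in-band entropy dock, as a named implication.** -/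
def EntropyDockInBand : Prop :=
  RelEntropyVanishingInBand → ImplosionDichotomy.HydroLimitInBand

/-! ## §2 The inputs of the ledger (v8: true-law inputs verbatim; reference-law inputs FAMILY-UNIFORM) -/

/-- **KCWU ALONG FAMILIES = `KineticCurrentsWindowLDFamily`** (v8; the family-uniform typing of the board item
`OneFlightGossipEngine.KineticCurrentsWindowLDUniform`, stmt-14662, that an entropy clock along a time-dependent reference can
consume). Same `η₀`-uniform packing guard, same class of fast kinetic currents `F = Σ A_jk w_j w_k + (b·w) G(x,|w|²)`,
`F ⊥ 1, v, |v|²` under the local Maxwellian, same scale-`N` exponential-moment bound over the kinetic window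
`w_N = τ (N+1)^{-1/3}` — but the data are one-parameter FAMILIES `s ↦ (a_s, θ_s, u_s; A_s, b_s, G_s)`, jointly continuous in
`(s, ·)`, the hypotheses are asked for every `s ∈ [0, t₁]`, and the thresholds `β₀, τ₀, N₀` are uniform: `∀ s ∈ [0,t₁]` is the
INNERMOST quantifier (as in the true-law inputs CAT / ECT). Window quantifier `∃ τ₀ ∀ τ ≥ τ₀` (the sharpening the 14680 lead
and its disprover asked of 14662), so that all channels of the ledger run on ONE common window. Constant families give back
the pointwise statement. -/
def KineticCurrentsWindowLDFamily : Prop :=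
  ∃ η₀ : ℝ, 0 < η₀ ∧ ∀ (t₁ : ℝ) (a θ₀ : ℝ → T3 → ℝ) (u₀ : ℝ → T3 → V3),
    Continuous (Function.uncurry a) → Continuous (Function.uncurry θ₀) → Continuous (Function.uncurry u₀) →
    (∀ s x, 0 < a s x) → (∀ s x, 0 < θ₀ s x) →
    ∀ σ : ℝ, 0 < σ → (∀ s ∈ Set.Icc 0 t₁, σ ^ 3 * (⨆ x, a s x) ≤ η₀ * ∫ x, a s x) →
    ∀ Φ : (N : ℕ) → HardSphereFlow (Torus.geometry (Fin 3)) (hsDiameter σ N) (N + 1),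
    ∀ (A : ℝ → T3 → Fin 3 → Fin 3 → ℝ) (b : ℝ → T3 → V3) (G : ℝ → T3 × ℝ → ℝ),
    Continuous (Function.uncurry A) → Continuous (Function.uncurry b) → Continuous (Function.uncurry G) →
    (let F := fun (s : ℝ) (y : T3 × V3) =>
       (∑ j : Fin 3, ∑ k : Fin 3, A s y.1 j k * ((y.2 - u₀ s y.1) j * (y.2 - u₀ s y.1) k)) +
         (∑ j : Fin 3, b s y.1 j * (y.2 - u₀ s y.1) j) * G s (y.1, ‖y.2 - u₀ s y.1‖ ^ 2)
     (∃ C : ℝ, ∀ s ∈ Set.Icc 0 t₁, ∀ y : T3 × V3, |F s y| ≤ C * (1 + ‖y.2‖ ^ 2)) →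
     (∀ s ∈ Set.Icc 0 t₁, ∀ x, ∫ v, F s (x, v) * localMaxwellian 1 (θ₀ s x) (u₀ s x) v = 0) →
     (∀ s ∈ Set.Icc 0 t₁, ∀ x (j : Fin 3),
        ∫ v, F s (x, v) * v j * localMaxwellian 1 (θ₀ s x) (u₀ s x) v = 0) →
     (∀ s ∈ Set.Icc 0 t₁, ∀ x, ∫ v, F s (x, v) * ‖v‖ ^ 2 * localMaxwellian 1 (θ₀ s x) (u₀ s x) v = 0) →
     ∃ β₀ : ℝ, 0 < β₀ ∧ ∀ β : ℝ, |β| ≤ β₀ → ∀ ε : ℝ, 0 < ε → ∃ τ₀ : ℝ, 0 < τ₀ ∧ ∀ τ : ℝ, τ₀ ≤ τ →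
     ∃ N₀ : ℕ, ∀ N : ℕ, N₀ ≤ N → ∀ s ∈ Set.Icc 0 t₁,
       ∫⁻ z, ENNReal.ofReal (Real.exp (β * ∑ i : Fin (N + 1),
           (τ * ((N : ℝ) + 1) ^ (-(1 / 3 : ℝ)))⁻¹ *
             ∫ r in (0 : ℝ)..(τ * ((N : ℝ) + 1) ^ (-(1 / 3 : ℝ))), F s ((Φ N).flow r z i)))
         ∂(localGibbsLaw σ (a s) (u₀ s) (θ₀ s) N (Φ N)) ≤
       ENNReal.ofReal (Real.exp (ε * ((N : ℝ) + 1))))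

/-- **The ENERGY-activity twin of `CollisionActivityTails`** (prices the energy part of the transfer clamp) — byte-identical with
the sibling's `CoherenceNotTails.CollisionEnergyActivityTails`. -/
def CollisionEnergyActivityTails : Prop :=
  ∀ (a₀ θ₀ : T3 → ℝ) (u₀ : T3 → V3), Continuous a₀ → Continuous θ₀ → Continuous u₀ → (∀ x, 0 < a₀ x) →
    (∀ x, 0 < θ₀ x) → ∃ σ₀ : ℝ, 0 < σ₀ ∧ ∀ σ : ℝ, 0 < σ → σ < σ₀ →
    ∀ (T : ℝ) (ρ θ : ℝ → T3 → ℝ) (u : ℝ → T3 → V3), IsHardSphereEulerSolution σ T ρ u θ →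
    ∀ Φ : (N : ℕ) → HardSphereFlow (Torus.geometry (Fin 3)) (hsDiameter σ N) (N + 1),
    TendstoHydroFieldsAt (fun N => localGibbsLaw σ a₀ u₀ θ₀ N (Φ N)) Φ ρ u θ 0 →
    ∀ t ∈ Set.Ico 0 T, ∃ V₀ : ℝ, 0 < V₀ ∧ ∀ V : ℝ, V₀ ≤ V → ∀ ε : ℝ, 0 < ε → ∃ τ₀ : ℝ, 0 < τ₀ ∧
    ∀ τ : ℝ, τ₀ ≤ τ → ∃ N₀ : ℕ, ∀ N : ℕ, N₀ ≤ N → ∀ s ∈ Set.Icc 0 t,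
      (let w : ℝ := τ * ((N : ℝ) + 1) ^ (-(1 / 3 : ℝ))
       let P := localGibbsLaw σ a₀ u₀ θ₀ N (Φ N)
       let act := fun (i : Fin (N + 1)) (z : Config (N + 1) (Fin 3) T3) =>
         σ / τ * (Φ N).collisionSum (Set.Ioc s (s + w))
           (fun c => if c.fst = i then |‖c.postVel.1‖ ^ 2 - ‖c.preVel.1‖ ^ 2| / 2 else 0) z
       ∫⁻ z, ENNReal.ofReal (((N : ℝ) + 1)⁻¹ * ∑ i : Fin (N + 1),
           Set.indicator {y : ℝ | V < y} (fun y => y) (act i z)) ∂P ≤ ENNReal.ofReal ε)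

/-- **The sibling line's true-law bet, RADIALLY WEIGHTED form = `CoherentSuprathermalContentVanishesW`** (v9; verbatim the
sibling crux 14680's S6′ after its finding CUTOFF-MATCHING: coherence is tested against a bounded measurable RADIAL WEIGHT `R`
vanishing below `K⋆²`, so that the ledger can feed KCWU-along-families the CONTINUOUS re-orthogonalised cut-off and test coherence with
the actual remainder profile; the sharp v8 form forced a discontinuous thermal cut-off into the kinetic class). Frame of ECT. -/
def CoherentSuprathermalContentVanishesW : Prop :=
  ∀ (a₀ θ₀ : T3 → ℝ) (u₀ : T3 → V3), Continuous a₀ → Continuous θ₀ → Continuous u₀ →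
    (∀ x, 0 < a₀ x) → (∀ x, 0 < θ₀ x) →
    ∃ σ₀ : ℝ, 0 < σ₀ ∧ ∀ σ : ℝ, 0 < σ → σ < σ₀ →
    ∀ (T : ℝ) (ρ θ : ℝ → T3 → ℝ) (u : ℝ → T3 → V3), IsHardSphereEulerSolution σ T ρ u θ →
    ∀ Φ : (N : ℕ) → HardSphereFlow (Torus.geometry (Fin 3)) (hsDiameter σ N) (N + 1),
    TendstoHydroFieldsAt (fun N => localGibbsLaw σ a₀ u₀ θ₀ N (Φ N)) Φ ρ u θ 0 →
    ∀ t ∈ Set.Ico 0 T, ∃ Kstar : ℝ, 0 < Kstar ∧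
    ∀ R : ℝ → T3 → ℝ → ℝ, Measurable (fun p : ℝ × T3 × ℝ => R p.1 p.2.1 p.2.2) →
    (∀ s x s', s' ≤ Kstar ^ 2 → R s x s' = 0) → (∀ s x s', |R s x s'| ≤ |s'|) →
    ∀ η : ℝ, 0 < η → ∀ ε : ℝ, 0 < ε →
    ∃ τ₀ : ℝ, 0 < τ₀ ∧ ∀ τ : ℝ, τ₀ ≤ τ → ∃ N₀ : ℕ, ∀ N : ℕ, N₀ ≤ N → ∀ s ∈ Set.Icc 0 t,
      (let w : ℝ := τ * ((N : ℝ) + 1) ^ (-(1 / 3 : ℝ))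
       let P := localGibbsLaw σ a₀ u₀ θ₀ N (Φ N)
       let W := fun (i : Fin (N + 1)) (s r : ℝ) (z : Config (N + 1) (Fin 3) T3) =>
         ((Φ N).flow r z i).2 - u s ((Φ N).flow r z i).1
       let cub := fun (i : Fin (N + 1)) (s : ℝ) (z : Config (N + 1) (Fin 3) T3) =>
         w⁻¹ * ∫ r in s..(s + w), ‖W i s r z‖ ^ 3
       let cubHi := fun (i : Fin (N + 1)) (s : ℝ) (z : Config (N + 1) (Fin 3) T3) =>
         w⁻¹ * ∫ r in s..(s + w), (if Kstar < ‖W i s r z‖ then ‖W i s r z‖ ^ 3 else 0)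
       let qbar := fun (i : Fin (N + 1)) (s : ℝ) (z : Config (N + 1) (Fin 3) T3) =>
         w⁻¹ • ∫ r in s..(s + w), (R s ((Φ N).flow r z i).1 (‖W i s r z‖ ^ 2)) • W i s r z
       ∫⁻ z, ENNReal.ofReal (((N : ℝ) + 1)⁻¹ * ∑ i : Fin (N + 1),
              (if η * cub i s z < ‖qbar i s z‖ then cubHi i s z else 0)) ∂P ≤ ENNReal.ofReal ε)

/-- **The LOCAL clamped collisional-transfer window LD ALONG FAMILIES = `LocalClampedTransferWindowLDFamily`** (v8; the
family-uniform typing of the sibling's `CoherenceNotTails.LocalClampedTransferWindowLD`, whose counter-term coefficients passed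
the first-order statics audit of cycle 2). Same `η₀`-uniform packing guard, same transfer-activity clamp, same momentum / energy
rows with the local EOS projection (x-dependent coefficients through `ρ₀ = rhoLim (profileOf a_s)`, `Z`, `Z′`) and the
deterministic centring, same scale-`N` exponential-moment bound — but for one-parameter FAMILIES `s ↦ (a_s, θ_s, u_s; φ_s)`
(profiles jointly continuous, test function jointly smooth on `[0,t₁] × 𝕋³`), hypotheses for every `s ∈ [0,t₁]`, thresholds
`V₀, β₀, τ₀, N₀` uniform: `∀ s ∈ [0,t₁]` INNERMOST. Constant families give back the pointwise statement. -/
def LocalClampedTransferWindowLDFamily : Prop :=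
  ∃ η₀ : ℝ, 0 < η₀ ∧ ∀ (t₁ : ℝ) (a θ₀ : ℝ → T3 → ℝ) (u₀ : ℝ → T3 → V3) (ha : ∀ s, Continuous (a s)),
    Continuous (Function.uncurry a) → Continuous (Function.uncurry θ₀) → Continuous (Function.uncurry u₀) →
    ∀ (ha0 : ∀ s x, 0 < a s x), (∀ s x, 0 < θ₀ s x) → ∀ σ : ℝ, 0 < σ → σ < 1 / 2 →
    (∀ s ∈ Set.Icc 0 t₁, σ ^ 3 * (⨆ x, a s x) ≤ η₀ * ∫ x, a s x) →
    ∀ Φ : (N : ℕ) → HardSphereFlow (Torus.geometry (Fin 3)) (hsDiameter σ N) (N + 1),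
    ∀ φ : ℝ → T3 → ℝ, Torus.IsSmoothSpaceTimeOn (Set.Icc 0 t₁) φ →
    ∃ V₀ : ℝ, 0 < V₀ ∧ ∀ V : ℝ, V₀ ≤ V → ∃ β₀ : ℝ, 0 < β₀ ∧ ∀ β : ℝ, |β| ≤ β₀ → ∀ ε : ℝ, 0 < ε →
    ∃ τ₀ : ℝ, 0 < τ₀ ∧ ∀ τ : ℝ, τ₀ ≤ τ → ∃ N₀ : ℕ, ∀ N : ℕ, N₀ ≤ N → ∀ s ∈ Set.Icc 0 t₁,
      (let ρ₀ : T3 → ℝ := rhoLim (profileOf (a s) (ha s) (ha0 s)) σ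
       let w : ℝ := τ * ((N : ℝ) + 1) ^ (-(1 / 3 : ℝ))
       let P := localGibbsLaw σ (a s) (u₀ s) (θ₀ s) N (Φ N)
       let Z : T3 → ℝ := fun x => hsCompressibility (ρ₀ x * σ ^ 3)
       let Z' : T3 → ℝ := fun x => deriv hsCompressibility (ρ₀ x * σ ^ 3)
       let act := fun (i : Fin (N + 1)) (z : Config (N + 1) (Fin 3) T3) =>
         σ / τ * (Φ N).collisionSum (Set.Ioc 0 w) (fun c => if c.fst = i then
           ‖c.postVel.1 - c.preVel.1‖ + |‖c.postVel.1‖ ^ 2 - ‖c.preVel.1‖ ^ 2| / 2 else 0) z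
       let ω := fun (i : Fin (N + 1)) (z : Config (N + 1) (Fin 3) T3) => if act i z ≤ V then (1 : ℝ) else 0
       let Xm := fun (k : Fin 3) (z : Config (N + 1) (Fin 3) T3) =>
         (Φ N).collisionSum (Set.Ioc 0 w)
           (fun c => ω c.fst z * ω c.snd z * ((φ s c.fstPos - φ s c.sndPos) * (c.postVel.1 k - c.preVel.1 k)) / 2) z
       let Am := fun (k : Fin 3) (z : Config (N + 1) (Fin 3) T3) =>
         (∫ r in (0 : ℝ)..w, ∑ i : Fin (N + 1), Torus.partialDeriv k (φ s) ((Φ N).flow r z i).1 *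
           (θ₀ s ((Φ N).flow r z i).1 * (ρ₀ ((Φ N).flow r z i).1 * σ ^ 3) * Z' ((Φ N).flow r z i).1 +
             (1 / 3) * (Z ((Φ N).flow r z i).1 - 1) * ‖((Φ N).flow r z i).2 - u₀ s ((Φ N).flow r z i).1‖ ^ 2)) -
         w * ((N : ℝ) + 1) * ∫ x, ρ₀ x * Torus.partialDeriv k (φ s) x * (θ₀ s x * (ρ₀ x * σ ^ 3) * Z' x)
       let Xe := fun (z : Config (N + 1) (Fin 3) T3) =>
         (Φ N).collisionSum (Set.Ioc 0 w)
           (fun c => ω c.fst z * ω c.snd z *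
             ((φ s c.fstPos - φ s c.sndPos) * ((‖c.postVel.1‖ ^ 2 - ‖c.preVel.1‖ ^ 2) / 2)) / 2) z
       let Ae := fun (z : Config (N + 1) (Fin 3) T3) =>
         (∫ r in (0 : ℝ)..w, ∑ i : Fin (N + 1),
           ((∑ l : Fin 3, u₀ s ((Φ N).flow r z i).1 l * Torus.partialDeriv l (φ s) ((Φ N).flow r z i).1) *
               (θ₀ s ((Φ N).flow r z i).1 * (ρ₀ ((Φ N).flow r z i).1 * σ ^ 3) * Z' ((Φ N).flow r z i).1 +
                 (1 / 3) * (Z ((Φ N).flow r z i).1 - 1) * ‖((Φ N).flow r z i).2 - u₀ s ((Φ N).flow r z i).1‖ ^ 2) +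
             θ₀ s ((Φ N).flow r z i).1 * (Z ((Φ N).flow r z i).1 - 1) *
               (∑ l : Fin 3, Torus.partialDeriv l (φ s) ((Φ N).flow r z i).1 *
                 (((Φ N).flow r z i).2 - u₀ s ((Φ N).flow r z i).1) l))) -
         w * ((N : ℝ) + 1) *
           ∫ x, ρ₀ x * (∑ l : Fin 3, u₀ s x l * Torus.partialDeriv l (φ s) x) * (θ₀ s x * (ρ₀ x * σ ^ 3) * Z' x)
       (∀ k : Fin 3, ∫⁻ z, ENNReal.ofReal (Real.exp (β * (w⁻¹ * Xm k z - w⁻¹ * Am k z))) ∂P ≤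
           ENNReal.ofReal (Real.exp (ε * ((N : ℝ) + 1)))) ∧
         ∫⁻ z, ENNReal.ofReal (Real.exp (β * (w⁻¹ * Xe z - w⁻¹ * Ae z))) ∂P ≤
           ENNReal.ofReal (Real.exp (ε * ((N : ℝ) + 1))))

/-- **The INPUTS of the ledger, bundled (v9)**: the LOCAL family-uniform collisional LD, the energy-activity tails, the
weighted coherent-suprathermal bet, KCWU along families, and the board items CAT (13734), ECT (9235) by name. None is attacked
by this line; the two family-uniform typings and CSCV-W are new statements (planner: file them; 14662 as typed is not consumable
by any clock along a time-dependent reference — `UNIFORMITY-9133-c2.md`; the sibling's `LineInputs` is the same list minus the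
board items). -/
def LineInputs : Prop :=
  LocalClampedTransferWindowLDFamily ∧ CollisionEnergyActivityTails ∧ CoherentSuprathermalContentVanishesW ∧
    KineticCurrentsWindowLDFamily ∧ OneFlightGossipEngine.CollisionActivityTails ∧
    OneFlightGossipEngine.EnergyCurrentTails

/-! ## §3 Landed one-window identities of this line (R1, R4) -/

/-- **R1 = `WindowEntropyBalance`** — the exact one-window entropy balance identity at finite `N` (LANDED p102880). -/
def WindowEntropyBalance : Prop :=
  ∀ (σ : ℝ), 0 < σ → σ ≤ 1 / 2 →
  ∀ (a₀ θ₀ : T3 → ℝ) (u₀ : T3 → V3), Continuous a₀ → Continuous θ₀ → Continuous u₀ →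
    (∀ x, 0 < a₀ x) → (∀ x, 0 < θ₀ x) →
  ∀ (b ϑ : T3 → ℝ) (w : T3 → V3), Literature.Analysis.FunctionSpaces.Torus.IsSmooth b →
    Literature.Analysis.FunctionSpaces.Torus.IsSmooth ϑ → Literature.Analysis.FunctionSpaces.Torus.IsSmooth w →
    (∀ x, 0 < b x) → (∀ x, 0 < ϑ x) →
  ∀ (b' ϑ' : T3 → ℝ) (w' : T3 → V3), Continuous b' → Continuous ϑ' → Continuous w' →
    (∀ x, 0 < b' x) → (∀ x, 0 < ϑ' x) →
  ∀ (N : ℕ) (Φ : HardSphereFlow (Torus.geometry (Fin 3)) (hsDiameter σ N) (N + 1)) (s h : ℝ), 0 ≤ s → 0 ≤ h →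
    (klDiv (Φ.lawAt (localGibbsLaw σ a₀ u₀ θ₀ N Φ) (s + h)) (localGibbsLaw σ b' w' ϑ' N Φ)).toReal -
        (klDiv (Φ.lawAt (localGibbsLaw σ a₀ u₀ θ₀ N Φ) s) (localGibbsLaw σ b w ϑ N Φ)).toReal =
      -(∫ z, ((∫ r in (0 : ℝ)..h,
                ((∑ i, Literature.Analysis.FunctionSpaces.Torus.fderiv
                    (fun x => Real.log (b x) - 3 / 2 * Real.log (2 * Real.pi * ϑ x) - ‖w x‖ ^ 2 / (2 * ϑ x))
                    ((Φ.flow r z i).1) ((Φ.flow r z i).2)) +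
                  momentumStreaming (fun x => (ϑ x)⁻¹ • w x) (Φ.flow r z) +
                  energyStreaming (fun x => -(ϑ x)⁻¹) (Φ.flow r z))) +
              Φ.momentumTransfer (fun x => (ϑ x)⁻¹ • w x) z h +
              Φ.energyTransfer (fun x => -(ϑ x)⁻¹) z h)
          ∂(Φ.lawAt (localGibbsLaw σ a₀ u₀ θ₀ N Φ) s)) +
        (∫ z, ((∑ i, (Real.log (b (z i).1) - 3 / 2 * Real.log (2 * Real.pi * ϑ (z i).1) -
                  ‖(z i).2 - w (z i).1‖ ^ 2 / (2 * ϑ (z i).1))) -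
              ∑ i, (Real.log (b' (z i).1) - 3 / 2 * Real.log (2 * Real.pi * ϑ' (z i).1) -
                  ‖(z i).2 - w' (z i).1‖ ^ 2 / (2 * ϑ' (z i).1)))
          ∂(Φ.lawAt (localGibbsLaw σ a₀ u₀ θ₀ N Φ) (s + h))) +
        (Real.log (posPartition b' (hsDiameter σ N) (N + 1)) - Real.log (posPartition b (hsDiameter σ N) (N + 1)))

/-- **R4 = `EulerPrimitiveInBand`** — hs-Euler in primitive variables in band (LANDED p103739). -/
def EulerPrimitiveInBand : Prop :=
  ∀ (η₀ σ : ℝ), 0 < η₀ → 0 < σ →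
  ∀ (χ f : ℝ → ℝ), ContDiff ℝ ((⊤ : ℕ∞) : WithTop ℕ∞) χ →
    (∀ r : ℝ, 0 ≤ r → r * σ ^ 3 ≤ η₀ → χ r = hsCompressibility (r * σ ^ 3)) →
  ∀ (T : ℝ) (ρ θ : ℝ → T3 → ℝ) (u : ℝ → T3 → V3), IsHardSphereEulerSolution σ T ρ u θ →
    (∀ t ∈ Set.Ico 0 T, ∀ x, ρ t x * σ ^ 3 ≤ η₀) →
    CompressibleEuler.IsPrimitiveEulerSolutionOn (CompressibleEuler.EulerEOS.monatomicExcess χ f) (Set.Ico 0 T) ρ u θ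

/-! ## §4 The ledger, in band (v9: the heart layer shared with crux 14680) -/

/-- **S7a (shared with the sibling, verbatim) = `LedgerAprioriBound`** — the a-priori entropy bound along the explicit reference
family: for `Rf ∈ [1,2]` continuous on `[0,r]`, `0 < σ < 1/2`, a classical solution, `t ∈ (0,T)` with packing `ρ_s σ³ < r` on
`[0,t]`, every `N`, every flow, the relative entropies `KL(lawAt Φ λ_N s ‖ localGibbsLaw σ (ρ_s·Rf(σ³ρ_s)) (u s) (θ s))`,
`s ∈ [0,t]`, are bounded by one real `B`. Provable now (finite-`N` bookkeeping `toReal_klDiv_lawAt_eq_integral` + bounds uniform on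
the compact `[0,t] × 𝕋³`); finiteness itself is `JaynesSqueezeClosure.klDiv_lawAt_localGibbsLaw_ne_top`. -/
def LedgerAprioriBound : Prop :=
  ∀ (r : ℝ) (Rf : ℝ → ℝ), 0 < r → (∀ x ∈ Icc 0 r, 1 ≤ Rf x ∧ Rf x ≤ 2) → ContinuousOn Rf (Icc 0 r) →
    ∀ (a₀ θ₀ : T3 → ℝ) (u₀ : T3 → V3), Continuous a₀ → Continuous θ₀ → Continuous u₀ →
      (∀ x, 0 < a₀ x) → (∀ x, 0 < θ₀ x) →
      ∀ σ : ℝ, 0 < σ → σ < 1 / 2 →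
        ∀ (T : ℝ) (ρ θ : ℝ → T3 → ℝ) (u : ℝ → T3 → V3), IsHardSphereEulerSolution σ T ρ u θ →
          ∀ t ∈ Set.Ioo 0 T, (∀ s ∈ Set.Icc 0 t, ∀ x, ρ s x * σ ^ 3 < r) →
            ∀ (N : ℕ) (Φ : HardSphereFlow (Torus.geometry (Fin 3)) (hsDiameter σ N) (N + 1)),
              ∃ B : ℝ, ∀ s ∈ Set.Icc 0 t,
                klDiv (Φ.lawAt (localGibbsLaw σ a₀ u₀ θ₀ N Φ) s)
                  (localGibbsLaw σ (fun x => ρ s x * Rf (σ ^ 3 * ρ s x)) (u s) (θ s) N Φ) ≤ ENNReal.ofReal B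

/-- **THE HEART'S TARGET = `LedgerIntegratedCoreInBand`** — the sibling's integrated ledger `LedgerIntegratedCore` (clause (ii)
of `ClampedCurrentsDockLedgerGlue.LedgerIntegralCore`) with `HsEosLowDensity → DiluteSelfConsistency →` REPLACED by an in-band
packing threshold `∃ ηp > 0` and the guard `ρ_s(x)σ³ < ηp` on `[0,T) × 𝕋³`: for every insertion factor `Rf` (four defining
properties) and every `η₀` carrying the matrix of `UniformLocalGibbsConcentration`, `∃ ηp` such that for continuous positive
profiles `∃ σ₀ ∀ σ < σ₀`, for every classical solution IN THE BAND, every tied flow family and `t ∈ (0,T)`: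
`∃ K ≥ 0 ∀ ε > 0 ∃ N₀ ∀ N ≥ N₀ ∀ t′ ∈ [0,t]: H_N(t′) ≤ (N+1)ε + K ∫₀^{t′} sup_{s ≤ r} H_N(s) dr`,
`H_N(s) := KL(lawAt Φ_N λ_N s ‖ localGibbsLaw σ (ρ_s Rf(σ³ρ_s)) (u s) (θ s))`. v8: the frame also carries the power series
and the Lipschitz bound of `Rf` (both delivered by `stub_eosRatioAnalytic`; the time-regularity of the reference family needs
them), which only weakens the statement. -/
def LedgerIntegratedCoreInBand : Prop :=
  ∀ (r : ℝ) (Rf : ℝ → ℝ), 0 < r →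
    (∃ p : FormalMultilinearSeries ℝ ℝ ℝ, HasFPowerSeriesOnBall Rf p 0 (ENNReal.ofReal r)) →
    (∃ L : NNReal, LipschitzOnWith L Rf (Icc 0 r)) →
    (∀ x ∈ Ioo (-r) r, 0 < Rf x ∧ Rf x * (∑' j : ℕ, bE j / (j.factorial : ℝ) * (x * Rf x) ^ j) = 1) →
    (∀ x ∈ Icc 0 r, 1 ≤ Rf x ∧ Rf x ≤ 2) → ContinuousOn Rf (Icc 0 r) →
    (∀ x ∈ Ioo (-r) r, ∀ R ∈ Icc (1 / 2 : ℝ) 2,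
      R * (∑' j : ℕ, bE j / (j.factorial : ℝ) * (x * R) ^ j) = 1 → R = Rf x) →
    ∀ η₀ : ℝ, 0 < η₀ →
    (∀ (a θ₀ : T3 → ℝ) (u₀ : T3 → V3), Continuous a → Continuous θ₀ → Continuous u₀ → (∀ x, 0 < a x) →
      (∀ x, 0 < θ₀ x) → ∀ σ : ℝ, 0 < σ → σ ^ 3 * (⨆ x, a x) ≤ η₀ * ∫ x, a x →
      ∃ ρ₀ : T3 → ℝ, Continuous ρ₀ ∧ (∀ x, 0 < ρ₀ x) ∧
        (∀ (N : ℕ) (Φ : HardSphereFlow (Torus.geometry (Fin 3)) (hsDiameter σ N) (N + 1)),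
          IsProbabilityMeasure (localGibbsLaw σ a u₀ θ₀ N Φ)) ∧
        ∀ χ : T3 → ℝ, Continuous χ → ∀ δ : ℝ, 0 < δ → ∃ C : ℝ, 0 < C ∧
          ∀ (N : ℕ) (Φ : HardSphereFlow (Torus.geometry (Fin 3)) (hsDiameter σ N) (N + 1)),
            localGibbsLaw σ a u₀ θ₀ N Φ {z | δ < |empiricalDensityField z χ - ∫ x, χ x * ρ₀ x|} ≤
                ENNReal.ofReal (C * Real.exp (-(C⁻¹ * ((N : ℝ) + 1)))) ∧
              localGibbsLaw σ a u₀ θ₀ N Φ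
                  {z | δ < ‖empiricalMomentumField z χ - ∫ x, (χ x * ρ₀ x) • u₀ x‖} ≤
                ENNReal.ofReal (C * Real.exp (-(C⁻¹ * ((N : ℝ) + 1)))) ∧
              localGibbsLaw σ a u₀ θ₀ N Φ {z | δ < |empiricalEnergyField z χ -
                  ∫ x, χ x * totalEnergyDensity (ρ₀ x) (u₀ x) (θ₀ x)|} ≤
                ENNReal.ofReal (C * Real.exp (-(C⁻¹ * ((N : ℝ) + 1))))) →
    ∃ ηp : ℝ, 0 < ηp ∧
    ∀ (a₀ θ₀ : T3 → ℝ) (u₀ : T3 → V3), Continuous a₀ → Continuous θ₀ → Continuous u₀ →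
      (∀ x, 0 < a₀ x) → (∀ x, 0 < θ₀ x) →
      ∃ σ₀ : ℝ, 0 < σ₀ ∧ ∀ σ : ℝ, 0 < σ → σ < σ₀ →
        ∀ (T : ℝ) (ρ θ : ℝ → T3 → ℝ) (u : ℝ → T3 → V3), IsHardSphereEulerSolution σ T ρ u θ →
          (∀ s ∈ Set.Ico 0 T, ∀ x, ρ s x * σ ^ 3 < ηp) →
          ∀ Φ : (N : ℕ) → HardSphereFlow (Torus.geometry (Fin 3)) (hsDiameter σ N) (N + 1),
            TendstoHydroFieldsAt (fun N => localGibbsLaw σ a₀ u₀ θ₀ N (Φ N)) Φ ρ u θ 0 →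
            ∀ t ∈ Set.Ioo 0 T,
              ∃ K : ℝ, 0 ≤ K ∧ ∀ ε : ℝ, 0 < ε → ∃ N₀ : ℕ, ∀ N : ℕ, N₀ ≤ N → ∀ t' ∈ Set.Icc 0 t,
                (klDiv ((Φ N).lawAt (localGibbsLaw σ a₀ u₀ θ₀ N (Φ N)) t')
                  (localGibbsLaw σ (fun x => ρ t' x * Rf (σ ^ 3 * ρ t' x)) (u t') (θ t') N (Φ N))).toReal ≤
                ((N : ℝ) + 1) * ε + K * ∫ r in (0 : ℝ)..t',
                  sSup ((fun s => (klDiv ((Φ N).lawAt (localGibbsLaw σ a₀ u₀ θ₀ N (Φ N)) s)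
                    (localGibbsLaw σ (fun x => ρ s x * Rf (σ ^ 3 * ρ s x)) (u s) (θ s) N (Φ N))).toReal) ''
                    Set.Icc 0 r)

/-- **v8 joint 1 = `WindowContinuityInBand`** — CRUDE SHORT-TIME CONTINUITY OF THE RELATIVE ENTROPY along the explicit
reference family, in band. For an insertion factor `Rf ∈ [1,2]`, Lipschitz on `[0,r]`, continuous positive profiles, there is
`σ₀` such that for `0 < σ < σ₀`, every classical solution, every tied flow family, `t ∈ (0,T)` with packing `ρ_s σ³ < r` on
`[0,t]`, every window scale `τ > 0` and `ε > 0`: for `N ≥ N₀` and all `s ≤ s′` in `[0,t]` with `s′ − s ≤ τ (N+1)^{-1/3}`,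
`|H_N(s′) − H_N(s)| ≤ (N+1) ε`. Intended proof (worker brief): the landed one-window balance identity R1 with the smooth
references `ψ_s`, `ψ_{s′}`; the streaming integral is `O((s′−s)(N+1))` in `L¹(f_s)` by conservation of `Σ|v_i|²`, bounded
third moments (ECT at one fixed level) and uniform bounds on the reference gradients; the transfer terms are bounded by the
window collisional activities (monotone in the window; CAT / CEAT at one fixed clamp level, contact ⇒ `|φ(x_i) − φ(x_j)| ≤
‖∇φ‖_∞ σ (N+1)^{-1/3}`), hence `O(τ (N+1)^{2/3})`; the reference switch `E_{f_{s′}}[Σ (g_{ψ_s} − g_{ψ_{s′}})] + log Z′/Z` is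
`O((s′−s)(N+1))` by the time-Lipschitz bounds of `(log(ρ Rf(σ³ρ)), u, θ)` on `[0,t] × 𝕋³`. [cite: Yau1991, §2] -/
def WindowContinuityInBand : Prop :=
  ∀ (r : ℝ) (Rf : ℝ → ℝ), 0 < r → (∀ x ∈ Icc 0 r, 1 ≤ Rf x ∧ Rf x ≤ 2) →
    (∃ L : NNReal, LipschitzOnWith L Rf (Icc 0 r)) →
    ∀ (a₀ θ₀ : T3 → ℝ) (u₀ : T3 → V3), Continuous a₀ → Continuous θ₀ → Continuous u₀ →
      (∀ x, 0 < a₀ x) → (∀ x, 0 < θ₀ x) →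
      ∃ σ₀ : ℝ, 0 < σ₀ ∧ ∀ σ : ℝ, 0 < σ → σ < σ₀ →
        ∀ (T : ℝ) (ρ θ : ℝ → T3 → ℝ) (u : ℝ → T3 → V3), IsHardSphereEulerSolution σ T ρ u θ →
          ∀ Φ : (N : ℕ) → HardSphereFlow (Torus.geometry (Fin 3)) (hsDiameter σ N) (N + 1),
            TendstoHydroFieldsAt (fun N => localGibbsLaw σ a₀ u₀ θ₀ N (Φ N)) Φ ρ u θ 0 →
            ∀ t ∈ Set.Ioo 0 T, (∀ s ∈ Set.Icc 0 t, ∀ x, ρ s x * σ ^ 3 < r) →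
              ∀ τ : ℝ, 0 < τ → ∀ ε : ℝ, 0 < ε → ∃ N₀ : ℕ, ∀ N : ℕ, N₀ ≤ N →
                ∀ s ∈ Set.Icc 0 t, ∀ s' ∈ Set.Icc 0 t, s ≤ s' → s' ≤ s + τ * ((N : ℝ) + 1) ^ (-(1 / 3 : ℝ)) →
                  |(klDiv ((Φ N).lawAt (localGibbsLaw σ a₀ u₀ θ₀ N (Φ N)) s')
                      (localGibbsLaw σ (fun x => ρ s' x * Rf (σ ^ 3 * ρ s' x)) (u s') (θ s') N (Φ N))).toReal -
                    (klDiv ((Φ N).lawAt (localGibbsLaw σ a₀ u₀ θ₀ N (Φ N)) s)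
                      (localGibbsLaw σ (fun x => ρ s x * Rf (σ ^ 3 * ρ s x)) (u s) (θ s) N (Φ N))).toReal| ≤
                  ((N : ℝ) + 1) * ε

/-- **v9 joint 2 = `OneWindowLedgerStatic` — THE HEART PROPER'S TARGET (verbatim the sibling crux 14680's v21 def = this line's
v8 `OneWindowLedgerInBand` — one common window, in band, END-supremum form — with the STATIC CHANNEL CARRIED EXPLICITLY, the sibling
lead's finding STATIC-TELESCOPING).** Same frame as `LedgerIntegratedCoreInBand`; conclusion `∃ K ≥ 0 ∃ Cst` continuous on `[0,t]`
with (static clause) `∀ ε ∃ N₀ ∀ N ≥ N₀ ∀ t′ ∈ [0,t]: |log Z_pos(a_{t′}) − log Z_pos(a_0) + (N+1)∫₀^{t′} Cst| ≤ (N+1)ε` and (window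
clause) `∀ ε > 0 ∃ τ > 0 ∃ N₀ ∀ N ≥ N₀ ∀ s ≥ 0`, `s + w_N ≤ t`:
`H_N(s + w_N) ≤ H_N(s) + K w_N sup_{[0, s + w_N]} H_N + w_N (N+1) ε + [log Z_pos(a_{s+w_N}) − log Z_pos(a_s)] + w_N (N+1) Cst(s)`,
`a_r = ρ_r Rf(σ³ρ_r)`. Why the static term: per window the bookkeeping leaves `Δ log Z_pos + Σ_rows c_row(s)` (the partition term
against the centring constants of the local EOS projections), whose per-window size is `w(N+1)·|e_N|` with `e_N` the error of the
MEAN one-body density LLN under `ψ_r` — `o(1)` pointwise in `r` by the statics at hand, but not provably `o(1)` at the window scale;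
TELESCOPED it is `o(N+1)` (log-partition increment + mean LLN + dominated convergence). [cite: Yau1991, §2; OllaVaradhanYau1993, §3] -/
def OneWindowLedgerStatic : Prop :=
  ∀ (r : ℝ) (Rf : ℝ → ℝ), 0 < r →
    (∃ p : FormalMultilinearSeries ℝ ℝ ℝ, HasFPowerSeriesOnBall Rf p 0 (ENNReal.ofReal r)) →
    (∃ L : NNReal, LipschitzOnWith L Rf (Icc 0 r)) →
    (∀ x ∈ Ioo (-r) r, 0 < Rf x ∧ Rf x * (∑' j : ℕ, bE j / (j.factorial : ℝ) * (x * Rf x) ^ j) = 1) →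
    (∀ x ∈ Icc 0 r, 1 ≤ Rf x ∧ Rf x ≤ 2) → ContinuousOn Rf (Icc 0 r) →
    (∀ x ∈ Ioo (-r) r, ∀ R ∈ Icc (1 / 2 : ℝ) 2,
      R * (∑' j : ℕ, bE j / (j.factorial : ℝ) * (x * R) ^ j) = 1 → R = Rf x) →
    ∀ η₀ : ℝ, 0 < η₀ →
    (∀ (a θ₀ : T3 → ℝ) (u₀ : T3 → V3), Continuous a → Continuous θ₀ → Continuous u₀ → (∀ x, 0 < a x) →
      (∀ x, 0 < θ₀ x) → ∀ σ : ℝ, 0 < σ → σ ^ 3 * (⨆ x, a x) ≤ η₀ * ∫ x, a x →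
      ∃ ρ₀ : T3 → ℝ, Continuous ρ₀ ∧ (∀ x, 0 < ρ₀ x) ∧
        (∀ (N : ℕ) (Φ : HardSphereFlow (Torus.geometry (Fin 3)) (hsDiameter σ N) (N + 1)),
          IsProbabilityMeasure (localGibbsLaw σ a u₀ θ₀ N Φ)) ∧
        ∀ χ : T3 → ℝ, Continuous χ → ∀ δ : ℝ, 0 < δ → ∃ C : ℝ, 0 < C ∧
          ∀ (N : ℕ) (Φ : HardSphereFlow (Torus.geometry (Fin 3)) (hsDiameter σ N) (N + 1)),
            localGibbsLaw σ a u₀ θ₀ N Φ {z | δ < |empiricalDensityField z χ - ∫ x, χ x * ρ₀ x|} ≤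
                ENNReal.ofReal (C * Real.exp (-(C⁻¹ * ((N : ℝ) + 1)))) ∧
              localGibbsLaw σ a u₀ θ₀ N Φ
                  {z | δ < ‖empiricalMomentumField z χ - ∫ x, (χ x * ρ₀ x) • u₀ x‖} ≤
                ENNReal.ofReal (C * Real.exp (-(C⁻¹ * ((N : ℝ) + 1)))) ∧
              localGibbsLaw σ a u₀ θ₀ N Φ {z | δ < |empiricalEnergyField z χ -
                  ∫ x, χ x * totalEnergyDensity (ρ₀ x) (u₀ x) (θ₀ x)|} ≤
                ENNReal.ofReal (C * Real.exp (-(C⁻¹ * ((N : ℝ) + 1))))) →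
    ∃ ηp : ℝ, 0 < ηp ∧
    ∀ (a₀ θ₀ : T3 → ℝ) (u₀ : T3 → V3), Continuous a₀ → Continuous θ₀ → Continuous u₀ →
      (∀ x, 0 < a₀ x) → (∀ x, 0 < θ₀ x) →
      ∃ σ₀ : ℝ, 0 < σ₀ ∧ ∀ σ : ℝ, 0 < σ → σ < σ₀ →
        ∀ (T : ℝ) (ρ θ : ℝ → T3 → ℝ) (u : ℝ → T3 → V3), IsHardSphereEulerSolution σ T ρ u θ →
          (∀ s ∈ Set.Ico 0 T, ∀ x, ρ s x * σ ^ 3 < ηp) →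
          ∀ Φ : (N : ℕ) → HardSphereFlow (Torus.geometry (Fin 3)) (hsDiameter σ N) (N + 1),
            TendstoHydroFieldsAt (fun N => localGibbsLaw σ a₀ u₀ θ₀ N (Φ N)) Φ ρ u θ 0 →
            ∀ t ∈ Set.Ioo 0 T,
              ∃ K : ℝ, 0 ≤ K ∧ ∃ Cst : ℝ → ℝ, ContinuousOn Cst (Set.Icc 0 t) ∧
                (∀ ε : ℝ, 0 < ε → ∃ N₀ : ℕ, ∀ N : ℕ, N₀ ≤ N → ∀ t' ∈ Set.Icc 0 t,
                  |Real.log (posPartition (fun x => ρ t' x * Rf (σ ^ 3 * ρ t' x)) (hsDiameter σ N) (N + 1)) -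
                      Real.log (posPartition (fun x => ρ 0 x * Rf (σ ^ 3 * ρ 0 x)) (hsDiameter σ N) (N + 1)) +
                    ((N : ℝ) + 1) * ∫ r in (0 : ℝ)..t', Cst r| ≤ ((N : ℝ) + 1) * ε) ∧
                ∀ ε : ℝ, 0 < ε → ∃ τ : ℝ, 0 < τ ∧ ∃ N₀ : ℕ, ∀ N : ℕ, N₀ ≤ N →
                ∀ s : ℝ, 0 ≤ s → s + τ * ((N : ℝ) + 1) ^ (-(1 / 3 : ℝ)) ≤ t →
                (klDiv ((Φ N).lawAt (localGibbsLaw σ a₀ u₀ θ₀ N (Φ N)) (s + τ * ((N : ℝ) + 1) ^ (-(1 / 3 : ℝ))))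
                  (localGibbsLaw σ (fun x => ρ (s + τ * ((N : ℝ) + 1) ^ (-(1 / 3 : ℝ))) x *
                      Rf (σ ^ 3 * ρ (s + τ * ((N : ℝ) + 1) ^ (-(1 / 3 : ℝ))) x))
                    (u (s + τ * ((N : ℝ) + 1) ^ (-(1 / 3 : ℝ)))) (θ (s + τ * ((N : ℝ) + 1) ^ (-(1 / 3 : ℝ))))
                    N (Φ N))).toReal ≤
                (klDiv ((Φ N).lawAt (localGibbsLaw σ a₀ u₀ θ₀ N (Φ N)) s)
                  (localGibbsLaw σ (fun x => ρ s x * Rf (σ ^ 3 * ρ s x)) (u s) (θ s) N (Φ N))).toReal +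
                K * (τ * ((N : ℝ) + 1) ^ (-(1 / 3 : ℝ))) *
                  sSup ((fun s' => (klDiv ((Φ N).lawAt (localGibbsLaw σ a₀ u₀ θ₀ N (Φ N)) s')
                    (localGibbsLaw σ (fun x => ρ s' x * Rf (σ ^ 3 * ρ s' x)) (u s') (θ s') N (Φ N))).toReal) ''
                    Set.Icc 0 (s + τ * ((N : ℝ) + 1) ^ (-(1 / 3 : ℝ)))) +
                (τ * ((N : ℝ) + 1) ^ (-(1 / 3 : ℝ))) * ((N : ℝ) + 1) * ε +
                ((Real.log (posPartition (fun x => ρ (s + τ * ((N : ℝ) + 1) ^ (-(1 / 3 : ℝ))) x *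
                      Rf (σ ^ 3 * ρ (s + τ * ((N : ℝ) + 1) ^ (-(1 / 3 : ℝ))) x)) (hsDiameter σ N) (N + 1)) -
                    Real.log (posPartition (fun x => ρ s x * Rf (σ ^ 3 * ρ s x)) (hsDiameter σ N) (N + 1))) +
                  (τ * ((N : ℝ) + 1) ^ (-(1 / 3 : ℝ))) * ((N : ℝ) + 1) * Cst s)

/-- **v9 joint 3 = `LedgerFromWindowsS`** — the summation with the static telescoping (verbatim the sibling's def; LANDED by the
sibling lead, p117552, `ClampedCurrentsDockFromWindows.stub_ledgerFromWindowsS`): the one-window ledger with static term, the window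
continuity and S7a imply the integrated ledger. -/
def LedgerFromWindowsS : Prop :=
  OneWindowLedgerStatic → WindowContinuityInBand → LedgerAprioriBound → LedgerIntegratedCoreInBand

/-- **THE HEART as ONE implication shared by both cruxes = `OneWindowLedger`** (v9; verbatim the sibling crux 14680's registered
`stub_oneWindowLedger` signature, with the four LANDED pathwise/pointwise pieces S2 `PathwiseEntropyProduction` (p98761), S8
`EulerCancellation` (p101112), S4 `EosConsistency` (p97592), S10 `TransferClampRemainder` (p100385) as leading hypotheses, referenced
here through their Theorems copies): the family-uniform local clamped collisional LD, the energy-activity tails, the weighted coherence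
input, KCWU along families, CAT and ECT imply `OneWindowLedgerStatic`. ONE landed proof closes this stub in both skeletons. -/
def OneWindowLedger : Prop :=
  PathwiseEntropyProduction → EulerCancellation → EosConsistency → TransferClampRemainder →
    LocalClampedTransferWindowLDFamily → CollisionEnergyActivityTails →
    CoherentSuprathermalContentVanishesW → KineticCurrentsWindowLDFamily → OneFlightGossipEngine.CollisionActivityTails →
    OneFlightGossipEngine.EnergyCurrentTails → OneWindowLedgerStatic

/-! ### §4b (v11, lead c3) The heart cut at its two CLAUSES: static (provable now from the sibling's landed SC-a/SC-b) and window

`OneWindowLedgerStatic` concludes `∃ K ≥ 0 ∃ Cst, ContinuousOn Cst [0,t] ∧ (static clause) ∧ (window clause)`. The two clauses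
share only the centring function, which the blueprint makes EXPLICIT: `Cst(s) = ∫ ρ_s (ρ_s σ³) Z′(ρ_s σ³) div u_s` (the
`Cst` of the sibling's landed SC-b `ClampedCurrentsDockStaticLimit.StaticLimit` and the centring total of CC1
`CollisionalIdentification`). With `Cst` explicit the heart splits into two independent registered stubs and a sorry-free glue. -/

/-- **Static clause of the heart, in band = `StaticClauseInBand`** (v11; L, provable NOW). Frame: the analytic insertion factor;
then `∃ ηs > 0` such that for continuous positive profiles, `0 < σ < 1/2`, every classical solution with packing `< ηs` on
`[0,T)`, every flow family TIED at `t = 0` (unit mass: `DenseExcursionEverywhere.integral_density_zero_eq_one` +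
`integral_density_eq`) and `t ∈ (0,T)`: the explicit centring `Cst` is continuous on `[0,t]` and
`∀ ε ∃ N₀ ∀ N ≥ N₀ ∀ t′ ∈ [0,t]: |log Z_pos(a_{t′}) − log Z_pos(a_0) + (N+1)∫₀^{t′} Cst| ≤ (N+1)ε`, `a_r = ρ_r Rf(σ³ρ_r)`.
Proof: the sibling's landed SC-b `ClampedCurrentsDockStaticLimit.stub_staticLimit` (smoothness/positivity of `a`, `Z_pos > 0`,
continuity of `Cst`, the uniform bound and the pointwise limit `D_N/(N+1) → −Cst`) fed into its landed SC-a
`ClampedCurrentsDockStaticTelescoping.stub_staticTelescoping` with `ℓ := −Cst`. [cite: Yau1991, §2] -/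
def StaticClauseInBand : Prop :=
  ∀ (r : ℝ) (Rf : ℝ → ℝ), 0 < r →
    (∃ p : FormalMultilinearSeries ℝ ℝ ℝ, HasFPowerSeriesOnBall Rf p 0 (ENNReal.ofReal r)) →
    (∃ L : NNReal, LipschitzOnWith L Rf (Icc 0 r)) →
    (∀ x ∈ Ioo (-r) r, 0 < Rf x ∧ Rf x * (∑' j : ℕ, bE j / (j.factorial : ℝ) * (x * Rf x) ^ j) = 1) →
    (∀ x ∈ Icc 0 r, 1 ≤ Rf x ∧ Rf x ≤ 2) → ContinuousOn Rf (Icc 0 r) →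
    (∀ x ∈ Ioo (-r) r, ∀ R ∈ Icc (1 / 2 : ℝ) 2,
      R * (∑' j : ℕ, bE j / (j.factorial : ℝ) * (x * R) ^ j) = 1 → R = Rf x) →
    ∃ ηs : ℝ, 0 < ηs ∧
    ∀ (a₀ θ₀ : T3 → ℝ) (u₀ : T3 → V3), Continuous a₀ → Continuous θ₀ → Continuous u₀ →
      (∀ x, 0 < a₀ x) → (∀ x, 0 < θ₀ x) →
      ∀ σ : ℝ, 0 < σ → σ < 1 / 2 →
        ∀ (T : ℝ) (ρ θ : ℝ → T3 → ℝ) (u : ℝ → T3 → V3), IsHardSphereEulerSolution σ T ρ u θ →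
          (∀ s ∈ Set.Ico 0 T, ∀ x, ρ s x * σ ^ 3 < ηs) →
          ∀ Φ : (N : ℕ) → HardSphereFlow (Torus.geometry (Fin 3)) (hsDiameter σ N) (N + 1),
            TendstoHydroFieldsAt (fun N => localGibbsLaw σ a₀ u₀ θ₀ N (Φ N)) Φ ρ u θ 0 →
            ∀ t ∈ Set.Ioo 0 T,
              ContinuousOn (fun s : ℝ => ∫ x, ρ s x * (ρ s x * σ ^ 3) * deriv hsCompressibility (ρ s x * σ ^ 3) *
                  Torus.divergence (u s) x) (Set.Icc 0 t) ∧
              ∀ ε : ℝ, 0 < ε → ∃ N₀ : ℕ, ∀ N : ℕ, N₀ ≤ N → ∀ t' ∈ Set.Icc 0 t,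
                |Real.log (posPartition (fun x => ρ t' x * Rf (σ ^ 3 * ρ t' x)) (hsDiameter σ N) (N + 1)) -
                    Real.log (posPartition (fun x => ρ 0 x * Rf (σ ^ 3 * ρ 0 x)) (hsDiameter σ N) (N + 1)) +
                  ((N : ℝ) + 1) * ∫ r in (0 : ℝ)..t',
                    (∫ x, ρ r x * (ρ r x * σ ^ 3) * deriv hsCompressibility (ρ r x * σ ^ 3) *
                      Torus.divergence (u r) x)| ≤ ((N : ℝ) + 1) * ε

/-- **Window clause of the heart, in band = `WindowClauseInBand`** (v11; XL — THE HEART PROPER). Same frame as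
`OneWindowLedgerStatic` (insertion factor, `η₀` + the matrix of `UniformLocalGibbsConcentration`); conclusion: `∃ ηw > 0`, for
continuous positive profiles `∃ σ₀`, for `0 < σ < σ₀`, every classical solution with packing `< ηw` on `[0,T)`, every tied flow
family, `t ∈ (0,T)`: `∃ K ≥ 0 ∀ ε > 0 ∃ τ > 0 ∃ N₀ ∀ N ≥ N₀ ∀ s ≥ 0`, `s + w_N ≤ t` (`w_N = τ (N+1)^{-1/3}`):
`H_N(s + w_N) ≤ H_N(s) + K w_N sup_{[0,s+w_N]} H_N + w_N (N+1) ε + [log Z_pos(a_{s+w_N}) − log Z_pos(a_s)] + w_N (N+1) Cst(s)`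
with the EXPLICIT centring `Cst(s) = ∫ ρ_s (ρ_s σ³) Z′(ρ_s σ³) div u_s`. Blueprint (the sibling's heart design, all channel lemmas
LANDED under `Theorems/OneFlightGossipEngineClampedCurrentsDock*.lean`): C0 balance on `[s, s+w]`; S8 pointwise `Dg = fast − P`
along `a_s = ρ_s Rf(σ³ρ_s)` (E8 bridge from S4); flow shift FS to the window `(0,w]` of `Φ_s z`; freeze `r → s` (FZ; third moments
TM from ECT at accuracy 1; `E Σ act ≤ (N+1)(V+ε)`): `O(w² N)`; CC1: `∫ΣP_s − collSum K_s = −Σ_rows(X − A) + w(N+1)Cst(s) + Rem`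
(`ρ₀ = rhoLim(profileOf a_s) = ρ_s` by `EntropyClockDock.activity_of_density`), `E|Rem| ≤ 2Lw(N+1)ε` by CC3; four rows by ES at
tilt `−β` with LC1 (+ MZ), the low kinetic part by ES at tilt `−β` with KC1, the high part by QC-b; `β = min(β₀^{KC1}, β₀^{LC1})`
fixed after `(t, V, K⋆)` and before `ε`, `K = 5/β`. [cite: Yau1991, §2; OllaVaradhanYau1993, §3] -/
def WindowClauseInBand : Prop :=
  ∀ (r : ℝ) (Rf : ℝ → ℝ), 0 < r →
    (∃ p : FormalMultilinearSeries ℝ ℝ ℝ, HasFPowerSeriesOnBall Rf p 0 (ENNReal.ofReal r)) →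
    (∃ L : NNReal, LipschitzOnWith L Rf (Icc 0 r)) →
    (∀ x ∈ Ioo (-r) r, 0 < Rf x ∧ Rf x * (∑' j : ℕ, bE j / (j.factorial : ℝ) * (x * Rf x) ^ j) = 1) →
    (∀ x ∈ Icc 0 r, 1 ≤ Rf x ∧ Rf x ≤ 2) → ContinuousOn Rf (Icc 0 r) →
    (∀ x ∈ Ioo (-r) r, ∀ R ∈ Icc (1 / 2 : ℝ) 2,
      R * (∑' j : ℕ, bE j / (j.factorial : ℝ) * (x * R) ^ j) = 1 → R = Rf x) →
    ∀ η₀ : ℝ, 0 < η₀ →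
    (∀ (a θ₀ : T3 → ℝ) (u₀ : T3 → V3), Continuous a → Continuous θ₀ → Continuous u₀ → (∀ x, 0 < a x) →
      (∀ x, 0 < θ₀ x) → ∀ σ : ℝ, 0 < σ → σ ^ 3 * (⨆ x, a x) ≤ η₀ * ∫ x, a x →
      ∃ ρ₀ : T3 → ℝ, Continuous ρ₀ ∧ (∀ x, 0 < ρ₀ x) ∧
        (∀ (N : ℕ) (Φ : HardSphereFlow (Torus.geometry (Fin 3)) (hsDiameter σ N) (N + 1)),
          IsProbabilityMeasure (localGibbsLaw σ a u₀ θ₀ N Φ)) ∧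
        ∀ χ : T3 → ℝ, Continuous χ → ∀ δ : ℝ, 0 < δ → ∃ C : ℝ, 0 < C ∧
          ∀ (N : ℕ) (Φ : HardSphereFlow (Torus.geometry (Fin 3)) (hsDiameter σ N) (N + 1)),
            localGibbsLaw σ a u₀ θ₀ N Φ {z | δ < |empiricalDensityField z χ - ∫ x, χ x * ρ₀ x|} ≤
                ENNReal.ofReal (C * Real.exp (-(C⁻¹ * ((N : ℝ) + 1)))) ∧
              localGibbsLaw σ a u₀ θ₀ N Φ
                  {z | δ < ‖empiricalMomentumField z χ - ∫ x, (χ x * ρ₀ x) • u₀ x‖} ≤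
                ENNReal.ofReal (C * Real.exp (-(C⁻¹ * ((N : ℝ) + 1)))) ∧
              localGibbsLaw σ a u₀ θ₀ N Φ {z | δ < |empiricalEnergyField z χ -
                  ∫ x, χ x * totalEnergyDensity (ρ₀ x) (u₀ x) (θ₀ x)|} ≤
                ENNReal.ofReal (C * Real.exp (-(C⁻¹ * ((N : ℝ) + 1))))) →
    ∃ ηw : ℝ, 0 < ηw ∧
    ∀ (a₀ θ₀ : T3 → ℝ) (u₀ : T3 → V3), Continuous a₀ → Continuous θ₀ → Continuous u₀ →
      (∀ x, 0 < a₀ x) → (∀ x, 0 < θ₀ x) →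
      ∃ σ₀ : ℝ, 0 < σ₀ ∧ ∀ σ : ℝ, 0 < σ → σ < σ₀ →
        ∀ (T : ℝ) (ρ θ : ℝ → T3 → ℝ) (u : ℝ → T3 → V3), IsHardSphereEulerSolution σ T ρ u θ →
          (∀ s ∈ Set.Ico 0 T, ∀ x, ρ s x * σ ^ 3 < ηw) →
          ∀ Φ : (N : ℕ) → HardSphereFlow (Torus.geometry (Fin 3)) (hsDiameter σ N) (N + 1),
            TendstoHydroFieldsAt (fun N => localGibbsLaw σ a₀ u₀ θ₀ N (Φ N)) Φ ρ u θ 0 →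
            ∀ t ∈ Set.Ioo 0 T,
              ∃ K : ℝ, 0 ≤ K ∧
                ∀ ε : ℝ, 0 < ε → ∃ τ : ℝ, 0 < τ ∧ ∃ N₀ : ℕ, ∀ N : ℕ, N₀ ≤ N →
                ∀ s : ℝ, 0 ≤ s → s + τ * ((N : ℝ) + 1) ^ (-(1 / 3 : ℝ)) ≤ t →
                (klDiv ((Φ N).lawAt (localGibbsLaw σ a₀ u₀ θ₀ N (Φ N)) (s + τ * ((N : ℝ) + 1) ^ (-(1 / 3 : ℝ))))
                  (localGibbsLaw σ (fun x => ρ (s + τ * ((N : ℝ) + 1) ^ (-(1 / 3 : ℝ))) x *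
                      Rf (σ ^ 3 * ρ (s + τ * ((N : ℝ) + 1) ^ (-(1 / 3 : ℝ))) x))
                    (u (s + τ * ((N : ℝ) + 1) ^ (-(1 / 3 : ℝ)))) (θ (s + τ * ((N : ℝ) + 1) ^ (-(1 / 3 : ℝ))))
                    N (Φ N))).toReal ≤
                (klDiv ((Φ N).lawAt (localGibbsLaw σ a₀ u₀ θ₀ N (Φ N)) s)
                  (localGibbsLaw σ (fun x => ρ s x * Rf (σ ^ 3 * ρ s x)) (u s) (θ s) N (Φ N))).toReal +
                K * (τ * ((N : ℝ) + 1) ^ (-(1 / 3 : ℝ))) *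
                  sSup ((fun s' => (klDiv ((Φ N).lawAt (localGibbsLaw σ a₀ u₀ θ₀ N (Φ N)) s')
                    (localGibbsLaw σ (fun x => ρ s' x * Rf (σ ^ 3 * ρ s' x)) (u s') (θ s') N (Φ N))).toReal) ''
                    Set.Icc 0 (s + τ * ((N : ℝ) + 1) ^ (-(1 / 3 : ℝ)))) +
                (τ * ((N : ℝ) + 1) ^ (-(1 / 3 : ℝ))) * ((N : ℝ) + 1) * ε +
                ((Real.log (posPartition (fun x => ρ (s + τ * ((N : ℝ) + 1) ^ (-(1 / 3 : ℝ))) x *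
                      Rf (σ ^ 3 * ρ (s + τ * ((N : ℝ) + 1) ^ (-(1 / 3 : ℝ))) x)) (hsDiameter σ N) (N + 1)) -
                    Real.log (posPartition (fun x => ρ s x * Rf (σ ^ 3 * ρ s x)) (hsDiameter σ N) (N + 1))) +
                  (τ * ((N : ℝ) + 1) ^ (-(1 / 3 : ℝ))) * ((N : ℝ) + 1) *
                    (∫ x, ρ s x * (ρ s x * σ ^ 3) * deriv hsCompressibility (ρ s x * σ ^ 3) *
                      Torus.divergence (u s) x))

/-- **The window clause as an implication from the ten antecedents of `OneWindowLedger` = `WindowClause`** (registered stub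
signature `stub_windowClause`). -/
def WindowClause : Prop :=
  PathwiseEntropyProduction → EulerCancellation → EosConsistency → TransferClampRemainder →
    LocalClampedTransferWindowLDFamily → CollisionEnergyActivityTails →
    CoherentSuprathermalContentVanishesW → KineticCurrentsWindowLDFamily → OneFlightGossipEngine.CollisionActivityTails →
    OneFlightGossipEngine.EnergyCurrentTails → WindowClauseInBand

/-- **Glue (v11, sorry-free): the two clauses give `OneWindowLedgerStatic`** — `ηp := min ηs ηw`, `σ₀ := min σ_w (1/2)`, `K` from
the window clause, `Cst` the explicit centring. [cite: Yau1991, §2] -/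
theorem oneWindowLedgerStatic_of_clauses (hS : StaticClauseInBand) (hW : WindowClauseInBand) : OneWindowLedgerStatic := by
  intro r Rf hr hana hLip hsol hbd hcont huniq η₀ hη₀ HU
  obtain ⟨ηs, hηs, HS⟩ := hS r Rf hr hana hLip hsol hbd hcont huniq
  obtain ⟨ηw, hηw, HW⟩ := hW r Rf hr hana hLip hsol hbd hcont huniq η₀ hη₀ HU
  refine ⟨min ηs ηw, lt_min hηs hηw, fun a₀ θ₀ u₀ ha hθ hu ha0 hθ0 => ?_⟩
  obtain ⟨σw, hσw, HWσ⟩ := HW a₀ θ₀ u₀ ha hθ hu ha0 hθ0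
  refine ⟨min σw (1 / 2), lt_min hσw (by norm_num), fun σ hσ hσlt T ρ θ u hE hguard Φ htie t ht => ?_⟩
  have hσw' : σ < σw := hσlt.trans_le (min_le_left _ _)
  have hσ2 : σ < 1 / 2 := hσlt.trans_le (min_le_right _ _)
  have hgs : ∀ s ∈ Set.Ico 0 T, ∀ x, ρ s x * σ ^ 3 < ηs := fun s hs x =>
    (hguard s hs x).trans_le (min_le_left _ _)
  have hgw : ∀ s ∈ Set.Ico 0 T, ∀ x, ρ s x * σ ^ 3 < ηw := fun s hs x =>
    (hguard s hs x).trans_le (min_le_right _ _)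
  obtain ⟨hCst, hstat⟩ := HS a₀ θ₀ u₀ ha hθ hu ha0 hθ0 σ hσ hσ2 T ρ θ u hE hgs Φ htie t ht
  obtain ⟨K, hK, hwin⟩ := HWσ σ hσ hσw' T ρ θ u hE hgw Φ htie t ht
  exact ⟨K, hK, _, hCst, hstat, hwin⟩

/-! ## §5 Stubs — v16 (lead c17, line cycle 18): the SIGNED band remainder (repair R1 of the refuted BCL)

v15's one registered stub `stub_itemizedInputs` (SEET ∧ BCL ∧ LCTF ∧ EAT ∧ KCWF ∧ CAT, items 17701/17700/17691/17703/16659/13734) is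
STUB-FALSE: its conjunct `OneFlightGossipEngine.BandCoherenceLDAlongFamilies` (BCL, stmt-17700) is refuted by the Galilean-boost witness
(refuter rattack-17700-0; crux-ideate 17700 k1/k2; the 17700 lead lands `not_BandCoherenceLDAlongFamilies`, helpers
`Theorems/BandCoherenceLDAlongFamilies/Negative/*` in tree): the coherence functional `Σ 1{η cub < ‖q̄‖} cubBand` has non-zero LINEAR
response to a boost `D e₀` of the homogeneous reference law (flow-invariant), whose entropy cost `(N+1)D²/2θ` is quadratic, while the
statement asks the exponential moment at the FIXED tilt `(8Θ̄K₁)⁻¹` to be `≤ e^{ε(N+1)}` for every `ε` (and every `η`).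
RESHAPE (same composition idea — Yau's relative entropy along the explicit clamped reference family, the landed rate dock
`ClampedTransferDockSketch.clampedTransferDock_of_inputs` p140743 — re-threaded around BCL): the suprathermal heat-flux remainder
`hi = (b·w)(|w|² − 5θ − G)` of the rate cubic channel is no longer normed particle by particle and split by coherence; its BAND part is
paid SIGNED, as the Nachtergaele–Yau truncation `(b·w)G_b(x,|w|²)` re-orthogonalised to the collision invariants (`BandShiftStatics`,
static, provable), a member of KCWF's class of growth `C_B K₁`, by the two-sided entropy inequality at the tilt `β₀/(C_B K₁)`
(`CubicChannelRateS`, provable) — which needs the tilt threshold of the kinetic window LD UNIFORM over the normalised class: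
`KineticCurrentsLDAlongFamiliesQ` (KCWF-Q, the new conjecture-grade input; it implies KCWF = stmt-16659, `kcwf_of_kcwfQ`). The cut-off
`G` of KC1 must come with its orthogonality (`KineticInstanceOrth`, provable re-export of the landed KC1), and the D-shape one-window
ledger is re-plumbed over the signed channel with a byte-identical conclusion (`WindowClauseRateS`, provable), so that the landed
`stub_ledgerEndD` (p139514), window continuity (p118327), a-priori bound, reduction and dock apply unchanged (`HydroLimitInBand_of`).
Input cone of the line after v16: {KCWF-Q, LCT 17691, SEET 17701, EAT 17703, CAT 13734} — BCL and KCWF(16659) leave it.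

Registered stubs (v16): `stub_kcwfQ` (conjecture-grade input, to be promoted to an item), `stub_items4` (four items, delegated to their
seats) — the only `sorry`s left — and the four provable ones, ALL CLOSED in cycle 18: `stub_bandShiftStatics` (p147261),
`stub_kineticInstanceOrth` (p146924), `stub_windowClauseRateS` (p146888) (workers), `stub_cubicChannelRateS` (p146424, lead). -/

open Summit.AtomisticToContinuum.HydrodynamicLimit.Theorems.HydroLimitInBandSignedBand
  (KineticCurrentsLDAlongFamiliesQ BandShiftStatics KineticInstanceOrth CubicChannelRateS WindowClauseRateS kcwf_of_kcwfQ)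

/-! The five v16 statements — `KineticCurrentsLDAlongFamiliesQ` (KCWF-Q, conjecture-grade input), `BandShiftStatics`,
`KineticInstanceOrth`, `CubicChannelRateS`, `WindowClauseRateS` — and the glue `kcwf_of_kcwfQ : KCWF-Q → KCWF` are LANDED once, in
`Theorems/ImplosionDichotomyHydroLimitInBandSignedBandDefs.lean` (p145654, namespace `HydroLimitInBandSignedBand`), and opened here. -/

/-- **v16 STUB (conjecture-grade INPUT, not a worker target): KCWF-Q.** To be promoted to a route item replacing stmt-17700 (BCL,
refuted); implies stmt-16659 (KCWF). -/
theorem stub_kcwfQ : KineticCurrentsLDAlongFamiliesQ := by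
  sorry

/-- **v16 STUB (four ITEMS of route OneFlightGossipEngine, bundled; NOT a worker target — each conjunct is discharged by the closing
theorem of its own item):** `SuperExponentialEnergyTails` (stmt-17701), `LocalClampedTransferLDAlongFamilies` (stmt-17691, = LCTF of this
line), `EnergyActivityTails` (stmt-17703, = CEAT), `CollisionActivityTails` (stmt-13734, = CAT). -/
theorem stub_items4 :
    OneFlightGossipEngine.SuperExponentialEnergyTails ∧ OneFlightGossipEngine.LocalClampedTransferLDAlongFamilies ∧
      OneFlightGossipEngine.EnergyActivityTails ∧ OneFlightGossipEngine.CollisionActivityTails := by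
  sorry

/-- **v16 stub — the re-orthogonalised band truncation: CLOSED (p147261, worker W1 of lead c17;
`Theorems/ImplosionDichotomyHydroLimitInBandBandShiftStatics.lean` + prelim p146738, static Gaussian analysis over a parameter space).** -/
theorem stub_bandShiftStatics : BandShiftStatics :=
  Theorems.HydroLimitInBandBandShift.stub_bandShiftStatics -- LANDED p147261

/-- **v16 stub — KC1 with the orthogonality of its cut-off exported: CLOSED (p146924, worker W2 of lead c17;
`Theorems/ImplosionDichotomyHydroLimitInBandKineticInstanceOrth.lean`, 226 lines).** -/
theorem stub_kineticInstanceOrth : KineticInstanceOrth :=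
  Theorems.HydroLimitInBandKineticInstanceOrth.stub_kineticInstanceOrth -- LANDED p146924

/-- **v16 stub — the signed rate cubic channel: CLOSED (p146424, lead c17; `Theorems/ImplosionDichotomyHydroLimitInBandCubicChannelS.lean`,
370 lines; helpers `…CubicChannelSPrelim.lean` p145940 — `signedWindow_expectation`, the two-sided entropy step).** -/
theorem stub_cubicChannelRateS : CubicChannelRateS :=
  Theorems.HydroLimitInBandCubicChannelS.stub_cubicChannelRateS -- LANDED p146424

/-- **v16 stub — the D-shape one-window ledger over the signed cubic channel: CLOSED (p146888, worker W3 of lead c17;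
`Theorems/ImplosionDichotomyHydroLimitInBandWindowClauseS.lean`, 289 lines of quantifier plumbing adapted from `stub_windowClauseRate`).** -/
theorem stub_windowClauseRateS : WindowClauseRateS :=
  Theorems.HydroLimitInBandWindowClauseS.stub_windowClauseRateS -- LANDED p146888

/-- **Kernel check (v14, sorry-free): the itemized LCTF (stmt-17691) IS this file's §2 copy** and the OfHeart copy, definitionally. -/
theorem lctf_iff_item :
    LocalClampedTransferWindowLDFamily ↔ OneFlightGossipEngine.LocalClampedTransferLDAlongFamilies :=
  Iff.rfl

/-- **Kernel check (v14, sorry-free): the itemized CEAT (stmt-17703) IS this file's §2 copy**, definitionally. -/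
theorem ceat_iff_item : CollisionEnergyActivityTails ↔ OneFlightGossipEngine.EnergyActivityTails :=
  Iff.rfl

/-- **S7a — CLOSED (p109679, wave 2 of cycle 2; SHARED with crux 14680's `stub_ledgerApriori`):**
`EntropyClockDock.ledgerAprioriBound` (Theorems/ImplosionDichotomyHydroLimitInBandLedgerApriori.lean). -/
theorem stub_ledgerAprioriBound : LedgerAprioriBound :=
  Theorems.EntropyClockDock.ledgerAprioriBound -- LANDED p109679

/-- **v8 joint 1 (L, provable now; worker) — window continuity in band from the true-law inputs.** CAT (momentum activity),
CEAT (energy activity) and ECT (cubic tails) — each at ONE fixed level — give the crude short-time continuity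
`WindowContinuityInBand` of `H_N` along the explicit reference family. -/
theorem stub_windowContinuityInBand :
    OneFlightGossipEngine.CollisionActivityTails → CollisionEnergyActivityTails →
      OneFlightGossipEngine.EnergyCurrentTails → WindowContinuityInBand :=
  Theorems.HydroLimitInBandContinuity.stub_windowContinuityInBand -- LANDED p118327 (v10: import enabled)

/-- **v11 stub — the STATIC clause: CLOSED (p123605, worker of lead c3; `Theorems/ImplosionDichotomyHydroLimitInBandStaticClause.lean`,
23 lines over the sibling's landed SC-b/SC-a + unit mass).** -/
theorem stub_staticClause : StaticClauseInBand :=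
  Theorems.HydroLimitInBandHeart.stub_staticClause -- LANDED p123605

/-- **v11 stub — the WINDOW clause = THE HEART PROPER: CLOSED (p127017, lead c3; `Theorems/ImplosionDichotomyHydroLimitInBandWindowClause.lean`,
`HydroLimitInBandHeart.stub_windowClause`, 394 lines of quantifier plumbing over the sibling crux 14680's landed channel lemmas; v12: import enabled).** -/
theorem stub_windowClause : WindowClause :=
  Theorems.HydroLimitInBandHeart.stub_windowClause -- LANDED p127017

/-- **v9 joint 2 — THE SHARED HEART (one term with crux 14680's `stub_oneWindowLedger`), since v11 a sorry-free ONE-LINER over the two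
clause stubs: whichever lands first — the sibling's `stub_oneWindowLedger` or the two clauses here — closes both skeletons.** -/
theorem stub_oneWindowLedgerInBand : OneWindowLedger :=
  fun h₁ h₂ h₃ h₄ h₅ h₆ h₇ h₈ h₉ h₁₀ =>
    oneWindowLedgerStatic_of_clauses stub_staticClause (stub_windowClause h₁ h₂ h₃ h₄ h₅ h₆ h₇ h₈ h₉ h₁₀)

/-- **v9 joint 3 — CLOSED by the sibling lead (p117552):** `ClampedCurrentsDockFromWindows.stub_ledgerFromWindowsS`
(Theorems/OneFlightGossipEngineClampedCurrentsDockFromWindows.lean; statements byte-identical, closes by `delta`). -/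
theorem stub_ledgerFromWindowsS : LedgerFromWindowsS :=
  Theorems.ClampedCurrentsDockFromWindows.stub_ledgerFromWindowsS

/-! ## §6 Glue (sorry-free): the ledger end in band -/

/-- **The integrated ledger in band + the a-priori bound ⇒ the guarded Grönwall core.** With the analytic insertion factor of
`stub_eosRatioAnalytic` and the matrix of `uniformLocalGibbsConcentration_proof`: `η_c := min ηp (r/6)`,
`σ₀ := min σ_L (min σ_z (1/2))`. For the handed-over activity at time `t`, the landed G3
(`EntropyClockDock.referenceIdentificationInBand`) replaces its law by the explicit reference (`6σ³ sup ρ_t < r` from the guard);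
`H_N(0) = 0` by `QuenchedCellClock.stub_timeZeroReference` + `klDiv_lawAt_zero_localGibbsLaw`; the running-supremum Grönwall
`ClampedCurrentsDockLedgerGlue.le_mul_exp_of_integral_sSup` (landed for the sibling) gives `H_N(t) ≤ (N+1)ε e^{Kt}`; `ℝ≥0∞`
bookkeeping. [cite: Yau1991, §2] -/
theorem gronwallCoreInBand_of_ledger (hA : LedgerAprioriBound) (hL : LedgerIntegratedCoreInBand) : GronwallCoreInBand := by
  obtain ⟨r, hr, Rf, hana, -, -, hsol, hbd, hLip, huniq⟩ := Theorems.stub_eosRatioAnalytic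
  have hcont : ContinuousOn Rf (Set.Icc 0 r) := by
    obtain ⟨L, hL⟩ := hLip
    exact hL.continuousOn
  obtain ⟨ηU, hηU, HU⟩ := Theorems.uniformLocalGibbsConcentration_proof
  obtain ⟨ηp, hηp, HL⟩ := hL r Rf hr hana hLip hsol hbd hcont huniq ηU hηU HU
  refine ⟨min ηp (r / 6), lt_min hηp (by positivity), fun a₀ θ₀ u₀ ha hθ hu ha0 hθ0 => ?_⟩
  obtain ⟨σL, hσL, HσL⟩ := HL a₀ θ₀ u₀ ha hθ hu ha0 hθ0
  obtain ⟨σz, hσz, Hz⟩ :=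
    Theorems.QuenchedCellClock.stub_timeZeroReference hr hsol hbd hcont huniq a₀ θ₀ u₀ ha hθ hu ha0 hθ0
  refine ⟨min σL (min σz (1 / 2)), lt_min hσL (lt_min hσz (by norm_num)), ?_⟩
  intro σ hσ hσlt T ρ θ u hE hguard Φ htie t ht a hac hap hale hQs hlim
  have hσL' : σ < σL := hσlt.trans_le (min_le_left _ _)
  have hσz' : σ < σz := hσlt.trans_le ((min_le_right _ _).trans (min_le_left _ _))
  have hσ2' : σ < 1 / 2 := hσlt.trans_le ((min_le_right _ _).trans (min_le_right _ _))
  have hσ2 : σ ≤ 1 / 2 := hσ2'.le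
  have hT : 0 < T := ht.1.trans ht.2
  have htI : t ∈ Set.Ico 0 T := ⟨ht.1.le, ht.2⟩
  -- the Euler slice at time `t`
  have hρtc : Continuous (ρ t) := (hE.smooth_density.isSmooth_slice htI).continuous
  have hρtpos : ∀ x, 0 < ρ t x := hE.density_pos t htI
  -- packing from THE GUARD: `< ηp` on `[0,T)`, `< r` on `[0,t]`, and `6 σ³ sup ρ_t < r`
  have hpackp : ∀ s ∈ Set.Ico 0 T, ∀ x, ρ s x * σ ^ 3 < ηp := fun s hs x =>
    (hguard s hs x).trans_le (min_le_left _ _)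
  have hpackr : ∀ s ∈ Set.Icc 0 t, ∀ x, ρ s x * σ ^ 3 < r := fun s hs x =>
    ((hguard s ⟨hs.1, hs.2.trans_lt ht.2⟩ x).trans_le (min_le_right _ _)).trans_le (by linarith)
  have h6 : 6 * (σ ^ 3 * ⨆ x, ρ t x) < r := by
    have hbdd : BddAbove (Set.range (ρ t)) := (isCompact_range hρtc).bddAbove
    obtain ⟨xM, -, hxM⟩ := isCompact_univ.exists_isMaxOn Set.univ_nonempty hρtc.continuousOn
    have hsup : (⨆ x, ρ t x) = ρ t xM :=
      le_antisymm (ciSup_le fun x => (isMaxOn_iff.mp hxM) x (Set.mem_univ x)) (le_ciSup hbdd xM)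
    have h1 : ρ t xM * σ ^ 3 < r / 6 := (hguard t htI xM).trans_le (min_le_right _ _)
    rw [hsup, mul_comm (σ ^ 3)]
    linarith
  -- G3 (landed): the handed-over reference IS the explicit one
  have hlaw : ∀ N : ℕ, localGibbsLaw σ a (u t) (θ t) N (Φ N) =
      localGibbsLaw σ (fun x => ρ t x * Rf (σ ^ 3 * ρ t x)) (u t) (θ t) N (Φ N) := fun N =>
    (Theorems.EntropyClockDock.referenceIdentificationInBand r Rf hr huniq σ hσ (ρ t) a hac hap hρtc hρtpos hale
      hQs hlim h6 (u t) (θ t) N (Φ N)).symm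
  simp only [hlaw]
  -- the ledger in band and the a-priori bound, along the explicit reference family
  obtain ⟨K, hK, hstep⟩ := HσL σ hσ hσL' T ρ θ u hE hpackp Φ htie t ht
  have hB : ∀ N : ℕ, ∃ B : ℝ, ∀ s ∈ Set.Icc 0 t,
      klDiv ((Φ N).lawAt (localGibbsLaw σ a₀ u₀ θ₀ N (Φ N)) s)
        (localGibbsLaw σ (fun x => ρ s x * Rf (σ ^ 3 * ρ s x)) (u s) (θ s) N (Φ N)) ≤ ENNReal.ofReal B :=
    fun N => hA r Rf hr hbd hcont a₀ θ₀ u₀ ha hθ hu ha0 hθ0 σ hσ hσ2' T ρ θ u hE t ht hpackr N (Φ N)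
  have hlaw0 := Hz σ hσ hσz' T ρ θ u hE hT Φ htie
  -- adapted from `ClampedCurrentsDockLedgerGlue.stub_ledgerGronwall` (the sibling's ledger end, landed)
  set H : ℕ → ℝ → ℝ := fun N s =>
    (klDiv ((Φ N).lawAt (localGibbsLaw σ a₀ u₀ θ₀ N (Φ N)) s)
      (localGibbsLaw σ (fun x => ρ s x * Rf (σ ^ 3 * ρ s x)) (u s) (θ s) N (Φ N))).toReal with hH
  have hHnn : ∀ N s, 0 ≤ H N s := fun N s => ENNReal.toReal_nonneg
  have hH0 : ∀ N, H N 0 = 0 := by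
    intro N
    simp only [hH, hlaw0 N, Theorems.EntropyClockDock.klDiv_lawAt_zero_localGibbsLaw hσ2 ha hθ hu ha0 hθ0 N (Φ N),
      ENNReal.toReal_zero]
  have hreal : Tendsto (fun N : ℕ => H N t / ((N : ℝ) + 1)) atTop (𝓝 0) := by
    rw [Metric.tendsto_atTop]
    intro δ hδ
    set ε : ℝ := δ / (2 * Real.exp (K * t)) with hε
    have hεpos : 0 < ε := by positivity
    obtain ⟨N₀, hN₀⟩ := hstep ε hεpos
    refine ⟨N₀, fun N hN => ?_⟩
    have hNpos : (0 : ℝ) < (N : ℝ) + 1 := by positivity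
    obtain ⟨B, hBN⟩ := hB N
    have hHB : ∀ s ∈ Set.Icc 0 t, H N s ≤ max B 0 := by
      intro s hs
      exact ENNReal.toReal_le_of_le_ofReal (le_max_right _ _)
        ((hBN s hs).trans (ENNReal.ofReal_le_ofReal (le_max_left _ _)))
    have hmain : H N t ≤ ((N : ℝ) + 1) * ε * Real.exp (K * t) :=
      Theorems.ClampedCurrentsDockLedgerGlue.le_mul_exp_of_integral_sSup (H := H N) ht.1.le hK hHB (hH0 N)
        (fun t' ht' => hN₀ N hN t' ht')
    have hval : ((N : ℝ) + 1) * ε * Real.exp (K * t) = ((N : ℝ) + 1) * (δ / 2) := by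
      have hexp : Real.exp (K * t) ≠ 0 := (Real.exp_pos _).ne'
      rw [hε]
      field_simp
    have hq : H N t / ((N : ℝ) + 1) ≤ δ / 2 := by
      rw [div_le_iff₀ hNpos]
      calc H N t ≤ ((N : ℝ) + 1) * ε * Real.exp (K * t) := hmain
        _ = ((N : ℝ) + 1) * (δ / 2) := hval
        _ = δ / 2 * ((N : ℝ) + 1) := by ring
    have hq0 : 0 ≤ H N t / ((N : ℝ) + 1) := div_nonneg (hHnn N t) hNpos.le
    rw [Real.dist_eq, sub_zero, abs_of_nonneg hq0]
    linarith
  -- back to `ℝ≥0∞`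
  have hfin : ∀ N : ℕ, klDiv ((Φ N).lawAt (localGibbsLaw σ a₀ u₀ θ₀ N (Φ N)) t)
      (localGibbsLaw σ (fun x => ρ t x * Rf (σ ^ 3 * ρ t x)) (u t) (θ t) N (Φ N)) ≠ ⊤ := by
    intro N
    obtain ⟨B, hBN⟩ := hB N
    exact ne_top_of_le_ne_top ENNReal.ofReal_ne_top (hBN t ⟨ht.1.le, le_rfl⟩)
  have hcongr : ∀ N : ℕ, klDiv ((Φ N).lawAt (localGibbsLaw σ a₀ u₀ θ₀ N (Φ N)) t)
      (localGibbsLaw σ (fun x => ρ t x * Rf (σ ^ 3 * ρ t x)) (u t) (θ t) N (Φ N)) / ((N : ℝ≥0∞) + 1) =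
      ENNReal.ofReal (H N t / ((N : ℝ) + 1)) := by
    intro N
    have hNpos : (0 : ℝ) < (N : ℝ) + 1 := by positivity
    rw [ENNReal.ofReal_div_of_pos hNpos, hH, ENNReal.ofReal_toReal (hfin N)]
    congr 1
    rw [ENNReal.ofReal_add (by positivity) zero_le_one, ENNReal.ofReal_natCast, ENNReal.ofReal_one]
  simp only [hcongr]
  rw [← ENNReal.ofReal_zero]
  exact ENNReal.tendsto_ofReal hreal

/-- **C⁺ (v5's `stub_core`; v9 GLUE, sorry-free modulo the v9 stubs).** The guarded Grönwall core from the inputs: the shared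
heart (fed the sibling's four landed pathwise/pointwise pieces and the six inputs) delivers the one-window ledger with static term,
the landed window continuity and S7a integrate it (the sibling's landed `stub_ledgerFromWindowsS`), and `gronwallCoreInBand_of_ledger`
finishes. -/
theorem core_of_stubs : LineInputs → GronwallCoreInBand := fun hI =>
  gronwallCoreInBand_of_ledger stub_ledgerAprioriBound
    (stub_ledgerFromWindowsS
      (stub_oneWindowLedgerInBand Theorems.ClampedCurrentsDockPathwise.stub_pathwise
        Theorems.ClampedCurrentsDockCancellation.stub_cancellation Theorems.ClampedCurrentsDockEos.stub_eos
        Theorems.ClampedCurrentsDockClampRemainder.stub_transferClampRemainder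
        hI.1 hI.2.1 hI.2.2.1 hI.2.2.2.1 hI.2.2.2.2.1 hI.2.2.2.2.2)
      (stub_windowContinuityInBand hI.2.2.2.2.1 hI.2.1 hI.2.2.2.2.2)
      stub_ledgerAprioriBound)

/-! ## §7 The landed G3 target (kept for the record) -/

/-- **G3 target = `ReferenceIdentificationInBand`** — the handed-over activity and the explicit one give the same canonical law. -/
def ReferenceIdentificationInBand : Prop :=
  ∀ (r : ℝ) (Rf : ℝ → ℝ), 0 < r →
    (∀ x ∈ Set.Ioo (-r) r, ∀ R ∈ Set.Icc (1 / 2 : ℝ) 2,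
      R * (∑' j : ℕ, bE j / (j.factorial : ℝ) * (x * R) ^ j) = 1 → R = Rf x) →
    ∀ σ : ℝ, 0 < σ → ∀ (ρ a : T3 → ℝ) (hac : Continuous a) (hap : ∀ x, 0 < a x),
      Continuous ρ → (∀ x, 0 < ρ x) →
      (∀ x, ρ x ≤ a x ∧ a x ≤ 2 * ρ x) → SmallDensity (profileOf a hac hap) σ →
      rhoLim (profileOf a hac hap) σ = ρ → 6 * (σ ^ 3 * ⨆ x, ρ x) < r →
      ∀ (w : T3 → V3) (ϑ : T3 → ℝ) (N : ℕ)
        (Φ : HardSphereFlow (Torus.geometry (Fin 3)) (hsDiameter σ N) (N + 1)),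
        localGibbsLaw σ (fun x => ρ x * Rf (σ ^ 3 * ρ x)) w ϑ N Φ = localGibbsLaw σ a w ϑ N Φ

/-- **G3 — CLOSED (p107756, wave 1 of cycle 2):** `EntropyClockDock.referenceIdentificationInBand`
(Theorems/ImplosionDichotomyHydroLimitInBandReferenceIdentification.lean). -/
theorem stub_referenceIdentificationInBand : ReferenceIdentificationInBand :=
  Theorems.EntropyClockDock.referenceIdentificationInBand

/-! ## §8 The landed dock, reduction, R1, R4, and the composition -/

/-- **R1 — CLOSED (p102880).** `EntropyClockDock.windowEntropyBalance_identity`. -/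
theorem stub_windowEntropyBalance : WindowEntropyBalance :=
  Summit.AtomisticToContinuum.HydrodynamicLimit.Theorems.EntropyClockDock.windowEntropyBalance_identity

/-- **R4 — CLOSED (p103739).** `HydroLimitInBandClock.hsEuler_primitiveInBand`. -/
theorem stub_eulerPrimitiveInBand : EulerPrimitiveInBand :=
  Summit.AtomisticToContinuum.HydrodynamicLimit.Theorems.HydroLimitInBandClock.hsEuler_primitiveInBand

/-- **S2 — CLOSED (p97252).** `EntropyClockDock.relEntropyVanishingInBand_of_gronwallCoreInBand`. -/
theorem stub_reduction : GronwallCoreInBand → RelEntropyVanishingInBand :=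
  Summit.AtomisticToContinuum.HydrodynamicLimit.Theorems.EntropyClockDock.relEntropyVanishingInBand_of_gronwallCoreInBand

/-- **S1 — CLOSED (p97115).** `Theorems.hydroLimitInBand_of_relEntropyVanishingInBand`. -/
theorem stub_dock : EntropyDockInBand :=
  fun h => Summit.AtomisticToContinuum.HydrodynamicLimit.Theorems.hydroLimitInBand_of_relEntropyVanishingInBand h

/-- **The line closes the crux modulo its stubs (v16, PATH A re-threaded around the refuted BCL)**: `HydroLimitInBand` BY NAME —
KCWF from KCWF-Q; ECT from SEET (landed `ClampedTransferDockSeet.seet_imp_energyCurrentTails`, p141132); the D-shape one-window ledger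
from the signed window clause over the landed `stub_windowEstimateRate` (p136014), the signed cubic channel, the band statics and the
orthogonal KC1; window continuity (landed p118327); the guarded Grönwall core by the landed `stub_ledgerEndD` (p139514) with the landed
a-priori bound (p109679); reduction (p97252) and dock (p97115). `_root_.HydrodynamicLimit` and `ImplosionDichotomy.HydroLimitInBand`
unfold to the same term. -/
theorem HydroLimitInBand_of : ImplosionDichotomy.HydroLimitInBand := by
  obtain ⟨hS, hL, hE, hC⟩ := stub_items4
  have hK : Theorems.HydroLimitInBandOfHeart.KineticCurrentsWindowLDFamily := kcwf_of_kcwfQ stub_kcwfQ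
  have h₆ : OneFlightGossipEngine.EnergyCurrentTails := Theorems.ClampedTransferDockSeet.seet_imp_energyCurrentTails hS
  have hOW := stub_windowClauseRateS Theorems.ClampedTransferDockRate.stub_windowEstimateRate stub_cubicChannelRateS
    stub_bandShiftStatics stub_kineticInstanceOrth stub_kcwfQ hS hL hE hK hC h₆
  have hWC : Theorems.ClampedCurrentsDockFromWindows.WindowContinuityInBand :=
    Theorems.HydroLimitInBandContinuity.stub_windowContinuityInBand hC hE h₆
  have hG : Theorems.HydroLimitInBandOfHeart.GronwallCoreInBand :=
    Theorems.ClampedTransferDockLedgerEndD.stub_ledgerEndD hOW hWC Theorems.EntropyClockDock.ledgerAprioriBound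
  exact Theorems.hydroLimitInBand_of_relEntropyVanishingInBand
    (Theorems.EntropyClockDock.relEntropyVanishingInBand_of_gronwallCoreInBand hG)

/-- **PATH B (v1–v13's composition), sorry-free with its six inputs as HYPOTHESES**: `LineInputs → HydroLimitInBand` through this
file's own chain (core ⇒ guarded Yau target ⇒ crux); the in-tree twin is `HydroLimitInBandSplit.hydroLimitInBand_of_lineInputs`
(p136061). Kept because a proof of CSCV-W + TAT + ECT would still close the crux this way. -/
theorem hydrodynamicLimit_of_coherencePath (hI : LineInputs) : _root_.HydrodynamicLimit :=
  -- typed at the Statement `_root_.HydrodynamicLimit` (same term as the crux) so that the skeleton audit sees exactly ONE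
  -- theorem concluding the crux by name (`HydroLimitInBand_of`, PATH A)
  (show RelEntropyVanishingInBand → ImplosionDichotomy.HydroLimitInBand from stub_dock)
    (stub_reduction (core_of_stubs hI))

end Summit.AtomisticToContinuum.HydrodynamicLimit.Cruxes.HydroLimitInBand.IdeatorOneSketch

end
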